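import Literature.MathematicalPhysics.QuantumFieldTheory.Dimock2011to13.QED3BosonCommutatorBoundsTorus
import HarnessLib

/-!
# Dimock, *QED on the 3-torus. II*, §3.3 THEOREM 2, THE DERIVATIVE BOUNDS (196) — «`|∂G_{k,Λ,ω}(x,y)| ≤
# O(1)(O(1)M₀^{−1})^{|ω|}(L^{k−i}d′(x,y)^{−1} + d′(x,y)^{−2})exp(−O(1)d_Λ(x,y))`, `|∂G_{k,Λ}(x,y)| ≤ O(1)(L^{k−i}d′(x,y)^{−1}
# + d′(x,y)^{−2})exp(−O(1)d_Λ(x,y))`» — with the printed proof sentence «For the bounds on `∂G_{k,Λ,ω}` and `∂G_{k,Λ}` the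
# last step is (204)»: the DIFFERENTIATED random walk expansion (abstract, every path and summed) and the single-scale
# member ON THE DISCRETE 3-TORUS FROM LEMMA 3 ALONE (`dimock_thm2_deriv_torus_lemma3`)

statement-level skeleton of published theorems with citation tags; proofs where landed; nothing here is a claim about the Yang–Mills mass gap

**Citation header (reproduction of PUBLISHED work).** J. Dimock, *Quantum electrodynamics on the 3-torus. II. The
renormalization group flow*, arXiv:math-ph/0407063 (2004) [Dimock2004QED3TorusII], §3.3 «bosons», THEOREM 2 (194)–(196)
p.30 L1–13, LEMMA 3 (197)–(198) p.30 L14–22, proof (199)–(204) p.30 L24 – p.31 L12; §3.2 THEOREM 1 proof Part I (141)–(142)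
p.23 L26–40, Part III (152)–(155) p.24 L59 – p.25 L12 and §3.1 (124)–(126), LEMMA 1 (129)–(131) p.21 L36–45; of the held
arXiv text layer `paper:arxiv-math-ph_0407063` (`p.NN Lnn` = PDF page ∕ text-layer line).  Writer seat p11
(literature-prover-lit-balaban-p11-g25-0), YM LIT SWEEP item (c) D13 (row C13 «WHERE»; zero weight for the YM-INPRINT
tokens).  Imports the tree's `QED3BosonCommutatorBoundsTorus` (THEOREM 2 (195) on the torus from LEMMA 3:
`dimock_thm2_torus_lemma3`, `eq201_torus`, `rpow_neg_one_le_two_mul`; through it `QED3CommutatorBoundsTorus`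
(`norm_link0_le`, `torusDist_le_of_mem_tball`, `dOne_vmaVec_sub_le_of_mem_tball`, `rpow_neg_two_le_four_mul`),
`QED3SingleScaleTheorem1Torus` (`czmap_centre_site`, `card_filter_mem_tball_le`, `link0_eq_zero_of_far_torus`,
`H_mul_Kz_eq_zero_of_far_torus`, `torusDist_self'`, `torusDist_comm'`), `QED3WalkExpansionInverse` (`walkExpansion`,
`chainProd`, `link0`, `linkR`, `mul_listProd_apply`, `chainLinks_*`, `gstar_mul_kop_pow_apply`,
`chainProd_eq_zero_of_not_adj`), `QED3SingularWalkBound` (`dimock195`, `walks`, `mem_walks`), `QED3WalkLocality`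
(`link0_apply`), `QED3TorusPartitionOfUnity` (`abs_sub_g_torus_le`, `mem_tball_of_g_torus_ne_zero`),
`QED3BlockPotentialSumsTorus` (`hconv_shape_torus_boson`, `dprimeT_pos`, `dprimeT_triangle`), `QED3CommutatorBounds`
(`profile_hop_le`), `RandomWalkTorusDecay` (`sum_exp_torusDist_le`), `B12Decay510Window.K₁`).

**The printed text** (p.30 L1–13, p.31 L6–12).  *"Theorem 2 Let `M_0` be sufficiently large. Then `G_{k,Λ}` exists and
has the random walk expansion (194). We have `|G_{k,Λ,ω}(x,y)| ≤ O(1)(O(1)M_0^{−1})^{|ω|}d′(x,y)^{−1}exp(−O(1)d_Λ(x,y))`,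
`|G_{k,Λ}(x,y)| ≤ O(1)d′(x,y)^{−1}exp(−O(1)d_Λ(x,y))` (195) If `x ∈ δΛ^{(k)}_i` then `|∂G_{k,Λ,ω}(x,y)| ≤
O(1)(O(1)M_0^{−1})^{|ω|}(L^{k−i}d′(x,y)^{−1} + d′(x,y)^{−2})exp(−O(1)d_Λ(x,y))`, `|∂G_{k,Λ}(x,y)| ≤ O(1)(L^{k−i}d′(x,y)^{−1}
+ d′(x,y)^{−2})exp(−O(1)d_Λ(x,y))` (196) … The rest of the proof is as before and gives the result for `G_{k,Λ,ω}` and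
`G_{k,Λ}`. For the bounds on `∂G_{k,Λ,ω}` and `∂G_{k,Λ}` the last step is `∫_{Δ_1}(L^{k−i}d′(x,x_1)^{−1} +
d′(x,x_1)^{−2})(L^{2(k−i)}d′(x_1,y)^{−1} + L^{k−i}d′(x_1,y)^{−2})dx_1 ≤ O(1)(L^{k−i}d′(x,y)^{−1} + d′(x,y)^{−2})` (204) to
complete the proof."*  With (199) p.30 L24–31: *"`G_{k,Λ} = Σ_{n=0}^∞Σ_{□_0,□_1,…,□_n}(h_{□_0}G*_{□_0}h_{□_0})(R_{□_1}G*_{□_1}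
h_{□_1})⋯(R_{□_n}G*_{□_n}h_{□_n}) ≡ Σ_ωG_{k,Λ,ω}`"* and LEMMA 3 (198) p.30 L19–22: *"`|G*_□(x,y)| ≤ O(1)d′(x,y)^{−1}
exp(−O(1)d_Λ(x,y))`, `|∂G*_□(x,y)| ≤ O(1)(L^{k−i}d′(x,y)^{−1} + d′(x,y)^{−2})exp(−O(1)d_Λ(x,y))`"*.

**What is formalized (kernel-checked, zero `sorry`, no named facts).**  The derivative `∂` acts on the LEFT variable of
the kernel; on the lattice operators of the tree's `dimock_thm1` ∕ `walkExpansion` (square matrices over the finite site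
type `X`, entries in a complete normed `ℝ`-algebra `E`) it is LEFT MULTIPLICATION BY A SITE MATRIX `D` — for the forward
difference `∂_μ` the matrix with `(D·M)(x,y) = η^{−1}(M(x + e_μ,y) − M(x,y))` (§3, `exists_rowDiff_matrix`).  Then
`∂G_{k,Λ,ω} = D·G_{k,Λ,ω} = (D·h_{□_0}G*_{□_0}h_{□_0})(R_{□_1}G*_{□_1}h_{□_1})⋯` is the same chain with a DIFFERENTIATED FIRST
LINK, and the whole of Part III applies with the first-link profile of (196) in place of that of (195):
* §1 **the path count with a separate start count** — `card_walks_le₂`: `#{paths with n links} ≤ ν₀ν^n` for `≤ ν₀` start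
  cubes and `≤ ν` neighbours (the differentiated first link at `x` starts at the cubes of `x` AND of `x + e_μ`).
* §2 **the differentiated walk expansion (abstract)** — `dm_mul_chainProd` (`D·G_ω = (D·h_{□_0}G*_{□_0}h_{□_0})·Π_jR_{□_j}
  G*_{□_j}h_{□_j}`), `dm_mul_chainProd_apply_eq_zero_of_row`, **`norm_dm_mul_chainProd_apply_le`** = (196) FOR EVERY PATH:
  from `‖(D·h_□G*_□h_□)(u,v)‖ ≤ C₀′P₁(u,v)e^{−cd(u,v)}` (the differentiated first link, profile `P₁` = the printed
  `L^{k−i}d′^{−1} + d′^{−2}`), the later-link bound `‖(R_□G*_□h_□)(u,v)‖ ≤ (C₁∕M₀)Q(u,v)e^{−cd(u,v)}` ((201)) and the block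
  convolution bounds `Σ_ΔQQ ≤ θQ` ((202)) and `Σ_ΔP₁Q ≤ θP₁` (**(204)**, «the last step»): `‖(D·G_ω)(x,y)‖ ≤
  C₀′e^{3cr}(C₁θKe^{2cr}∕M₀)^{|ω|}P₁(x,y)e^{−(c∕2)d(x,y)}` — the tree's `dimock195` BY NAME; `dm_mul_gstar_mul_kop_pow_apply`
  (`(D·S*Rⁿ)(x,y) = Σ_ω(D·G_ω)(x,y)`), **`norm_dm_mul_gstar_mul_kop_pow_apply_le`** («we sum over paths», §1),
  `dm_mul_walkExpansion_apply` (`(D·G_{k,Λ})(x,y) = Σ'_n(D·S*Rⁿ)(x,y)`: a finite combination of convergent entry series),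
  and **`dimock_thm2_deriv`** = (196) SUMMED, abstract: under the entrywise convergence of (199) (conclusion (i) of
  `dimock_thm1`) and *"`M_0` sufficiently large"* = the SAME number `2νC₁θKe^{2cr} ≤ M₀` as for (195):
  `‖(D·G_{k,Λ})(x,y)‖ ≤ 2ν₀C₀′e^{3cr}·P₁(x,y)e^{−(c∕2)d(x,y)}`.
* §3 **the forward difference as a site matrix** — `exists_rowDiff_matrix` (any shift `s : X → X`, any factor `κ`).
* §4 **the differentiated first link ON THE TORUS from (145) and LEMMA 3 (198)** — `norm_fwdDiff_link0_le`: with `h_w :=` the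
  periodized (124) (`ℓ = ℓ_bM₀` sites per cube side), `e(x + e_μ) = e x + e_μ`, the value bound (198) (constant `C₀`) and
  the FORWARD-GRADIENT bound (198) (constant `C₀′`): `‖η^{−1}((h_wG_wh_w)(x + e_μ,v) − (h_wG_wh_w)(x,v))‖ ≤
  (4e^{6c}GC₀(ηℓ)^{−1} + C₀′)·η³(d′_T^{−1} + d′_T^{−2})(e x,e v)e^{−c·d(Δ_x,Δ_v)}` — the lattice product rule
  `h(x′)G(x′,v)h(v) − h(x)G(x,v)h(v) = [(h(x′) − h(x))G(x′,v) + h(x)(G(x′,v) − G(x,v))]h(v)`, `|h| ≤ 1`, «`∂h_□ = O(ℓ^{−1})`»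
  ((145) on the torus, `abs_sub_g_torus_le`), hop comparability of the profile (`d′_T(e x′,e v)^{−1} ≤ 2d′_T(e x,e v)^{−1}`,
  `d(Δ_{x′},Δ_v) ≥ d(Δ_x,Δ_v) − 6`).
* §5 **(196) SINGLE SCALE ON THE 3-TORUS** — `dimock_thm2_deriv_torus` (the torus geometry of `dimock_thm1_torus` discharged
  for the derivative engine: blocks, one-point sums `K₁(3,c∕2)`, adjacency `ν = 3³`, start cubes of the differentiated first
  link `ν₀ = 2·3³`), and **`dimock_thm2_deriv_torus_lemma3`** = THEOREM 2 (194)–(196) single scale on the 3-torus FROM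
  LEMMA 3 ALONE: hypotheses exactly those of `dimock_thm2_torus_lemma3` ((197) as `h_□AG*_□ = h_□`, (198) value + forward
  gradient, the kernel shapes of `−Δ + μ_k² + QᵀaQ`, the window ∕ size conditions, the explicit largeness); conclusions: the
  expansion (199) converges entrywise, `A·G_k = 1`, (195), AND **(196)**
  `‖η^{−1}(G_k(x + e_μ,y) − G_k(x,y))‖ ≤ 4·3³·(4e^{6c}GC₀(ηℓ)^{−1} + C₀′)·η³(d′_T^{−1} + d′_T^{−2})(e x,e y)e^{−(c∕2)d(Δ_x,Δ_y)}`
  — (204) at unit blocks IS (202) (`hconv_shape_torus_boson` BY NAME for both block bounds); **`dimock_thm2_deriv_torus_uniform'`**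
  (unit blocks `ηℓ_b = 1`, `a_Q = aη³`, bump at the cube corners, `M₀ ≥ 12`, `N_c ≥ 2`: ONE explicit `M₀` for all scales and
  volumes, constant `4·3³·(4e^{6c}GC₀ + C₀′)`); and **`dimock_thm2_path_torus_lemma3`** = the FIRST LINES of (195) and
  (196) — FOR EVERY PATH `ω` (the tree's `chainProd`), single scale on the 3-torus from LEMMA 3, no largeness needed:
  `‖G_{k,Λ,ω}(x,y)‖ ≤ C₀(C₁θ′K₁(3,c∕2)∕M₀)^{|ω|}·η³d′_T^{−1}e^{−(c∕2)d}` and `‖η^{−1}(G_{k,Λ,ω}(x + e_μ,y) − G_{k,Λ,ω}(x,y))‖ ≤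
  (4e^{6c}GC₀(ηℓ)^{−1} + C₀′)(C₁θ′K₁(3,c∕2)∕M₀)^{|ω|}·η³(d′_T^{−1} + d′_T^{−2})e^{−(c∕2)d}` — the printed
  `O(1)(O(1)M_0^{−1})^{|ω|}`.

**Readings (declared).**  (i) SINGLE SCALE (Remark 3 p.22 L28–30, full tori): `L^{k−i} = 1`, so the profile of (196) is
`d′^{−1} + d′^{−2}` = the later-link profile of (201), and «the last step (204)» coincides with (202); the multiscale
factors `L^{k−i}`, `L^{2(k−i)}` are not carried here (the abstract §2 allows any `P₁`, `Q`).  (ii) `∂` = the FORWARD lattice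
difference `η^{−1}(f(x + e_μ) − f(x))` in the left variable (paper I (21) conventions; `∂ᵀ` would be the same argument with
`x − e_μ`); as an operator on kernels-against-`Ση³` it is the plain row operation (no `η³`).  (iii) Decay currency and hop
comparability as in `QED3CommutatorBoundsTorus` ∕ `QED3BosonCommutatorBoundsTorus` (block-level periodic ℓ¹ distance, factor
`e^{6c}`).  (iv) «`x ∈ δΛ^{(k)}_i`» is empty bookkeeping on one scale.

**Honest scope.**  HYPOTHESES, in printed shape: LEMMA 3 ((197) as `h_□AG*_□ = h_□`, (198) value AND forward-gradient
bounds — the local inverses `G*_□` are not constructed), the kernel shapes of `A = −Δ + μ_k² + QᵀaQ`, `E` a complete normed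
`ℝ`-algebra with `‖1‖ = 1`, the window ∕ size conditions.  Single scale only; the MULTISCALE (196) (factors `L^{k−i}`,
regions `δΛ_i`, the metric (127)) and the backward derivative are not touched; nothing about LEMMA 3's own proof («much the
same way»).  No `d = 4` statement; nothing about Bałaban's papers beyond the reuse of the cell's torus carrier as geometry.
-/

noncomputable section

namespace Literature.MathematicalPhysics.QuantumFieldTheory.Dimock2011to13

namespace QED3TorusII

open Finset Real
open scoped NNReal
open RandomWalkExpansion (Kz Gstar Kop)
open Balaban1983to89.B13ScaleTransfer (Pt)
open Balaban1983to89.TreeLengthTorus (TPt proj natLift proj_natLift)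
open Balaban1983to89.B12Decay510Window (K₁)
open Balaban1983to89.B12Decay510Torus (vmaVec)
open RandomWalkTorusDecay (torusDist torusDist_nonneg torusDist_triangle sum_exp_torusDist_le)
open RegionVolume (box mem_box tball mem_tball tball_mono self_mem_tball czmap czmap_mem_tball mem_tball_of_czmap_eq
  proj_add)
open QED3SquarePartition (g g_nonneg g_le_one)

/-! ## §1 Counting the paths with a separate start count -/

section WalkCount

variable {C : Type*} [Fintype C] [DecidableEq C] {adj : C → C → Prop} [DecidableRel adj] {S₀ : Finset C}

/-- **The number of paths with `n` links is at most `ν₀ν^n`** when the start set has `≤ ν₀` cubes and every cube is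
adjacent to `≤ ν` cubes — the count of `card_walks_le` with the two sizes kept apart (the differentiated first link
`∂_μ(h_□G*_□h_□)(x,·)` starts at the cubes seeing `x` or `x + e_μ`).
[cite: Dimock2004QED3TorusII, §3.2 (132) p.22 L2–11 and proof of Thm 1 p.25 L10–12; §3.3 (196) p.30 L6–13] -/
theorem card_walks_le₂ {ν₀ ν : ℕ} (hS : S₀.card ≤ ν₀) (hadj : ∀ c, (univ.filter fun c' => adj c c').card ≤ ν) :
    ∀ n, (walks adj S₀ n).card ≤ ν₀ * ν ^ n
  | 0 => by
      rw [pow_zero, mul_one]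
      refine le_trans ?_ hS
      refine Finset.card_le_card_of_injOn (fun ω => ω 0) (fun ω hω => (mem_walks.1 (mem_coe.1 hω)).1) ?_
      intro ω _ ω' _ h
      funext j
      have hj : j = 0 := Fin.eq_zero j
      rw [hj]
      exact h
  | n + 1 => by
      have ih := card_walks_le₂ hS hadj n
      have hmaps : ∀ ω ∈ walks adj S₀ (n + 1),
          (⟨Fin.init ω, ω (Fin.last (n + 1))⟩ : Σ _ : Fin (n + 1) → C, C)
            ∈ (walks adj S₀ n).sigma fun ω' => univ.filter fun c' => adj (ω' (Fin.last n)) c' := by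
        intro ω hω
        rcases mem_walks.1 hω with ⟨h0, hadjω⟩
        rw [Finset.mem_sigma]
        refine ⟨mem_walks.2 ⟨?_, fun j => ?_⟩, ?_⟩
        · show ω (Fin.castSucc 0) ∈ S₀
          rw [Fin.castSucc_zero]; exact h0
        · show adj (ω j.castSucc.castSucc) (ω j.succ.castSucc)
          rw [← Fin.succ_castSucc]; exact hadjω j.castSucc
        · rw [Finset.mem_filter]
          refine ⟨mem_univ _, ?_⟩
          show adj (ω (Fin.last n).castSucc) (ω (Fin.last (n + 1)))
          rw [← Fin.succ_last]; exact hadjω (Fin.last n)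
      have hinj : Set.InjOn (fun ω : Fin (n + 2) → C => (⟨Fin.init ω, ω (Fin.last (n + 1))⟩ : Σ _ : Fin (n + 1) → C, C))
          (walks adj S₀ (n + 1) : Set (Fin (n + 2) → C)) := by
        intro ω _ ω' _ h
        simp only [Sigma.mk.injEq, heq_eq_eq] at h
        rw [← Fin.snoc_init_self ω, ← Fin.snoc_init_self ω', h.1, h.2]
      calc (walks adj S₀ (n + 1)).card
          ≤ ((walks adj S₀ n).sigma fun ω' => univ.filter fun c' => adj (ω' (Fin.last n)) c').card :=
            Finset.card_le_card_of_injOn _ hmaps hinj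
        _ = ∑ ω' ∈ walks adj S₀ n, (univ.filter fun c' => adj (ω' (Fin.last n)) c').card := Finset.card_sigma _ _
        _ ≤ ∑ _ω' ∈ walks adj S₀ n, ν := sum_le_sum fun ω' _ => hadj _
        _ = (walks adj S₀ n).card * ν := by rw [sum_const, smul_eq_mul]
        _ ≤ ν₀ * ν ^ n * ν := Nat.mul_le_mul_right _ ih
        _ = ν₀ * ν ^ (n + 1) := by ring

end WalkCount

/-! ## §2 The differentiated walk expansion: `D·G_{k,Λ} = Σ'_n(D·S*)Rⁿ`, (196) for every path and summed -/

section Derived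

variable {X : Type*} [Fintype X] [DecidableEq X] {E : Type*} [NormedRing E] [NormedAlgebra ℝ E]
variable {Z : Type*} [Fintype Z] [DecidableEq Z]

omit [NormedAlgebra ℝ E] [Fintype Z] [DecidableEq Z] in
/-- **`∂G_{k,Λ,ω}` is the chain with a differentiated first link**: `D·G_ω = (D·h_{□_0}G*_{□_0}h_{□_0})·(R_{□_1}G*_{□_1}h_{□_1})⋯`.
[cite: Dimock2004QED3TorusII, §3.3 (196) p.30 L6–13 with (199) p.30 L24–31] -/
theorem dm_mul_chainProd (D A : Matrix X X E) (H G : Z → Matrix X X E) {n : ℕ} (ω : Fin (n + 1) → Z) :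
    D * chainProd A H G ω = D * link0 H G (ω 0) * (List.ofFn fun j : Fin n => linkR A H G (ω j.succ)).prod :=
  (Matrix.mul_assoc _ _ _).symm

omit [NormedAlgebra ℝ E] [Fintype Z] [DecidableEq Z] in
/-- **`(D·G_ω)(x,y)` vanishes when the differentiated first link has a zero `x`-row** (the start-cube condition for `∂`).
[cite: Dimock2004QED3TorusII, §3.2 Thm 1 proof Part I p.23 L31–32; §3.3 (196) p.30 L6–13] -/
theorem dm_mul_chainProd_apply_eq_zero_of_row (D A : Matrix X X E) (H G : Z → Matrix X X E) {n : ℕ}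
    (ω : Fin (n + 1) → Z) (x y : X) (hrow : ∀ v, (D * link0 H G (ω 0)) x v = 0) :
    (D * chainProd A H G ω) x y = 0 := by
  rw [dm_mul_chainProd, Matrix.mul_apply]
  exact sum_eq_zero fun v _ => by rw [hrow v, zero_mul]

variable {B : Type*} [Fintype B] [DecidableEq B]
variable {d P₁ Q : X → X → ℝ} {blk : X → B} {ctr : B → X} {c r θ : ℝ}

omit [Fintype Z] [DecidableEq Z] in
/-- **(196) FOR EVERY PATH** (abstract): from the DIFFERENTIATED first-link bound `‖(D·h_□G*_□h_□)(u,v)‖ ≤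
C₀′P₁(u,v)e^{−cd(u,v)}` (profile `P₁`: the printed `L^{k−i}d′^{−1} + d′^{−2}`), the later-link bound `‖(R_□G*_□h_□)(u,v)‖ ≤
(C₁∕M₀)Q(u,v)e^{−cd(u,v)}` ((201)), the block convolution bounds `Σ_ΔQQ ≤ θQ` ((202)) and `Σ_ΔP₁Q ≤ θP₁` (**(204)**, «the
last step») and the geometry of the tree's `dimock195` (centres within `r`, one-point sum `K`):
`‖(D·G_ω)(x,y)‖ ≤ C₀′e^{3cr}(C₁θKe^{2cr}∕M₀)^{|ω|}P₁(x,y)e^{−(c∕2)d(x,y)}` — `dimock195` BY NAME.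
[cite: Dimock2004QED3TorusII, §3.3 Thm 2 (196) first line p.30 L6–10, proof (204) p.31 L6–12; §3.2 Thm 1 proof Part III (152)–(155) p.24 L59 – p.25 L10] -/
theorem norm_dm_mul_chainProd_apply_le (hθ : 0 ≤ θ) (hc : 0 ≤ c) (hQ0 : ∀ u v, 0 ≤ Q u v) (hP₁0 : ∀ u v, 0 ≤ P₁ u v)
    (hconv : ∀ (b : B) (u v : X),
      ∑ y ∈ univ.filter (fun u => blk u = b), (1 : ℝ) * (Q u y * Q y v) ≤ θ * Q u v)
    (hconv₁ : ∀ (b : B) (u v : X),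
      ∑ y ∈ univ.filter (fun u => blk u = b), (1 : ℝ) * (P₁ u y * Q y v) ≤ θ * P₁ u v)
    (hd0 : ∀ u v, 0 ≤ d u v) (hsymm : ∀ u v, d u v = d v u) (htri : ∀ u v t, d u t ≤ d u v + d v t)
    (hrad : ∀ u, d u (ctr (blk u)) ≤ r) {K : ℝ}
    (hK : ∀ b : B, ∑ b', Real.exp (-(c / 2) * d (ctr b) (ctr b')) ≤ K)
    (D A : Matrix X X E) (H G : Z → Matrix X X E) {C₀' C₁ M₀ : ℝ} (hC₀' : 0 ≤ C₀') (hC₁ : 0 ≤ C₁)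
    (hM₀ : 0 < M₀)
    (h0' : ∀ z u v, ‖(D * link0 H G z) u v‖ ≤ C₀' * (P₁ u v * Real.exp (-(c * d u v))))
    (hR : ∀ z u v, ‖linkR A H G z u v‖ ≤ C₁ / M₀ * (Q u v * Real.exp (-(c * d u v))))
    {n : ℕ} (ω : Fin (n + 1) → Z) (x y : X) :
    ‖(D * chainProd A H G ω) x y‖ ≤ C₀' * Real.exp (3 * c * r) * (C₁ * θ * K * Real.exp (2 * c * r) / M₀) ^ n
        * P₁ x y * Real.exp (-(c / 2) * d x y) := by
  rw [dm_mul_chainProd, mul_listProd_apply]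
  refine dimock195 (w := 1) zero_le_one hθ hc hQ0 hP₁0 hconv hconv₁ hd0 hsymm htri hrad hK hC₀' hC₁ hM₀
    _ ?_ ?_ n x y
  · intro u v
    rw [chainLinks_zero]
    exact h0' _ u v
  · intro j u v
    by_cases hj : j < n
    · rw [chainLinks_succ_of_lt _ _ hj]
      exact hR _ u v
    · rw [chainLinks_succ_of_le _ _ (not_lt.1 hj), norm_zero]
      exact mul_nonneg (div_nonneg hC₁ hM₀.le) (mul_nonneg (hQ0 u v) (Real.exp_pos _).le)

omit [NormedAlgebra ℝ E] [DecidableEq Z] [Fintype B] [DecidableEq B] in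
/-- **`(D·S*Rⁿ)(x,y) = Σ_{(□_0,…,□_n)}(D·G_ω)(x,y)`** — (199) differentiated, the `n`-link part entrywise (over ALL cube
sequences; non-paths contribute zero). [cite: Dimock2004QED3TorusII, §3.3 (199) p.30 L24–31 and (196) p.30 L6–13] -/
theorem dm_mul_gstar_mul_kop_pow_apply (D A : Matrix X X E) (H G : Z → Matrix X X E) (n : ℕ) (x y : X) :
    (D * (Gstar H G * Kop A H G ^ n)) x y = ∑ ω : Fin (n + 1) → Z, (D * chainProd A H G ω) x y := by
  rw [Matrix.mul_apply]
  have hw : ∀ w, (Gstar H G * Kop A H G ^ n) w y = ∑ ω : Fin (n + 1) → Z, chainProd A H G ω w y :=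
    fun w => gstar_mul_kop_pow_apply A H G n w y
  simp_rw [hw, Finset.mul_sum]
  rw [Finset.sum_comm]
  refine sum_congr rfl fun ω _ => ?_
  rw [Matrix.mul_apply]

variable (adj : Z → Z → Prop) [DecidableRel adj]

/-- **«we sum over paths», differentiated**: with `≤ ν₀` start cubes of the differentiated first link at `x` and `≤ ν`
cubes adjacent to any cube, `‖(D·S*Rⁿ)(x,y)‖ ≤ ν₀νⁿ·C₀′e^{3cr}(C₁θKe^{2cr}∕M₀)ⁿ·P₁(x,y)e^{−(c∕2)d(x,y)}` — (196) per path
times the path count of §1. [cite: Dimock2004QED3TorusII, §3.3 Thm 2 (196) p.30 L6–13, proof p.31 L6–12; §3.2 Thm 1 proof Part III p.25 L10–12] -/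
theorem norm_dm_mul_gstar_mul_kop_pow_apply_le (hθ : 0 ≤ θ) (hc : 0 ≤ c) (hQ0 : ∀ u v, 0 ≤ Q u v)
    (hP₁0 : ∀ u v, 0 ≤ P₁ u v)
    (hconv : ∀ (b : B) (u v : X),
      ∑ y ∈ univ.filter (fun u => blk u = b), (1 : ℝ) * (Q u y * Q y v) ≤ θ * Q u v)
    (hconv₁ : ∀ (b : B) (u v : X),
      ∑ y ∈ univ.filter (fun u => blk u = b), (1 : ℝ) * (P₁ u y * Q y v) ≤ θ * P₁ u v)
    (hd0 : ∀ u v, 0 ≤ d u v) (hsymm : ∀ u v, d u v = d v u) (htri : ∀ u v t, d u t ≤ d u v + d v t)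
    (hrad : ∀ u, d u (ctr (blk u)) ≤ r) {K : ℝ}
    (hK : ∀ b : B, ∑ b', Real.exp (-(c / 2) * d (ctr b) (ctr b')) ≤ K)
    (D A : Matrix X X E) (H G : Z → Matrix X X E) {C₀' C₁ M₀ : ℝ} (hC₀' : 0 ≤ C₀') (hC₁ : 0 ≤ C₁)
    (hM₀ : 0 < M₀)
    (h0' : ∀ z u v, ‖(D * link0 H G z) u v‖ ≤ C₀' * (P₁ u v * Real.exp (-(c * d u v))))
    (hR : ∀ z u v, ‖linkR A H G z u v‖ ≤ C₁ / M₀ * (Q u v * Real.exp (-(c * d u v))))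
    (hadj : ∀ z z', ¬ adj z z' → H z * Kz A H z' = 0) {ν₀ ν : ℕ}
    (hadjcard : ∀ z, (univ.filter fun z' => adj z z').card ≤ ν)
    (S₀' : X → Finset Z) (hS₀' : ∀ x, ∀ z ∉ S₀' x, ∀ v, (D * link0 H G z) x v = 0)
    (hS₀'card : ∀ x, (S₀' x).card ≤ ν₀) (n : ℕ) (x y : X) :
    ‖(D * (Gstar H G * Kop A H G ^ n)) x y‖
      ≤ (ν₀ : ℝ) * (ν : ℝ) ^ n * (C₀' * Real.exp (3 * c * r) * (C₁ * θ * K * Real.exp (2 * c * r) / M₀) ^ n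
          * P₁ x y * Real.exp (-(c / 2) * d x y)) := by
  rw [dm_mul_gstar_mul_kop_pow_apply]
  have hvanish : ∀ ω ∈ (univ : Finset (Fin (n + 1) → Z)), ω ∉ walks adj (S₀' x) n →
      (D * chainProd A H G ω) x y = 0 := by
    intro ω _ hω
    rw [mem_walks, not_and_or] at hω
    rcases hω with h1 | h2
    · exact dm_mul_chainProd_apply_eq_zero_of_row D A H G ω x y (hS₀' x _ h1)
    · rw [chainProd_eq_zero_of_not_adj A H G adj hadj ω h2, Matrix.mul_zero]
      rfl
  rw [← sum_subset (subset_univ (walks adj (S₀' x) n)) hvanish]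
  have hK0 : 0 ≤ K := (sum_nonneg fun b' _ => (Real.exp_pos _).le).trans (hK (blk x))
  set Φ := C₀' * Real.exp (3 * c * r) * (C₁ * θ * K * Real.exp (2 * c * r) / M₀) ^ n * P₁ x y *
    Real.exp (-(c / 2) * d x y) with hΦ
  have hq0 : 0 ≤ C₁ * θ * K * Real.exp (2 * c * r) / M₀ := by positivity
  have hΦ0 : 0 ≤ Φ :=
    mul_nonneg (mul_nonneg (mul_nonneg (mul_nonneg hC₀' (Real.exp_pos _).le) (pow_nonneg hq0 n)) (hP₁0 x y))
      (Real.exp_pos _).le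
  calc ‖∑ ω ∈ walks adj (S₀' x) n, (D * chainProd A H G ω) x y‖
      ≤ ∑ ω ∈ walks adj (S₀' x) n, ‖(D * chainProd A H G ω) x y‖ := norm_sum_le _ _
    _ ≤ ∑ _ω ∈ walks adj (S₀' x) n, Φ := sum_le_sum fun ω _ =>
        norm_dm_mul_chainProd_apply_le hθ hc hQ0 hP₁0 hconv hconv₁ hd0 hsymm htri hrad hK D A H G hC₀' hC₁ hM₀
          h0' hR ω x y
    _ = ((walks adj (S₀' x) n).card : ℝ) * Φ := by rw [sum_const, nsmul_eq_mul]
    _ ≤ (ν₀ : ℝ) * (ν : ℝ) ^ n * Φ :=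
        mul_le_mul_of_nonneg_right (by exact_mod_cast card_walks_le₂ (hS₀'card x) hadjcard n) hΦ0

omit [NormedAlgebra ℝ E] [DecidableEq Z] [Fintype B] [DecidableEq B] [DecidableRel adj] in
/-- **`(D·G_{k,Λ})(x,y) = Σ'_n(D·S*Rⁿ)(x,y)`**: the derivative goes under the sum over `n` of (199) — each entry of
`D·G_{k,Λ}` is a FINITE combination of the convergent entry series `Σ_n(S*Rⁿ)(w,y)`.
[cite: Dimock2004QED3TorusII, §3.3 (199) p.30 L24–31, (196) p.30 L6–13; §3.2 (141) p.23 L26–31] -/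
theorem dm_mul_walkExpansion_apply [CompleteSpace E] (D A : Matrix X X E) (H G : Z → Matrix X X E)
    (hsum : ∀ x y, Summable fun n => (Gstar H G * Kop A H G ^ n) x y) (x y : X) :
    (D * walkExpansion A H G) x y = ∑' n, (D * (Gstar H G * Kop A H G ^ n)) x y := by
  rw [Matrix.mul_apply]
  have hw : ∀ w, walkExpansion A H G w y = ∑' n, (Gstar H G * Kop A H G ^ n) w y := fun w => rfl
  have hrhs : ∀ n, (D * (Gstar H G * Kop A H G ^ n)) x y = ∑ w, D x w * (Gstar H G * Kop A H G ^ n) w y :=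
    fun n => Matrix.mul_apply
  simp_rw [hw, hrhs]
  rw [Summable.tsum_finsetSum (fun w _ => (hsum w y).mul_left (D x w))]
  exact sum_congr rfl fun w _ => ((hsum w y).tsum_mul_left (D x w)).symm

/-- **THEOREM 2 (196), SUMMED — the abstract engine.**  Given the entrywise convergence of the expansion (199)
(conclusion (i) of the tree's `dimock_thm1`), the later-link bound `‖(R_□G*_□h_□)(u,v)‖ ≤ (C₁∕M₀)Q(u,v)e^{−cd(u,v)}`
((201)), the DIFFERENTIATED first-link bound `‖(D·h_□G*_□h_□)(u,v)‖ ≤ C₀′P₁(u,v)e^{−cd(u,v)}` (from (198) and (145)), the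
block convolution bounds for `(Q,Q)` ((202)) and `(P₁,Q)` ((204)), the adjacency (`h_□R_{□′} = 0` for non-adjacent cubes,
`≤ ν` neighbours), `≤ ν₀` start cubes of the differentiated first link, and *"Let `M_0` be sufficiently large"* = the SAME
`2νC₁θKe^{2cr} ≤ M₀` as for (195): (a) every entry series `Σ_n(D·S*Rⁿ)(x,y)` converges absolutely; (b)
`(D·G_{k,Λ})(x,y) = Σ'_n(D·S*Rⁿ)(x,y)`; (c) **(196)** `‖(D·G_{k,Λ})(x,y)‖ ≤ 2ν₀C₀′e^{3cr}·P₁(x,y)e^{−(c∕2)d(x,y)}` — the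
printed `O(1)(L^{k−i}d′(x,y)^{−1} + d′(x,y)^{−2})exp(−O(1)d_Λ(x,y))` with its `O(1)`s explicit.
[cite: Dimock2004QED3TorusII, §3.3 Thm 2 (196) p.30 L6–13, proof p.31 L6–12 («the last step is (204)»); §3.2 Thm 1 proof Part III p.25 L10–12] -/
theorem dimock_thm2_deriv [CompleteSpace E] (hθ : 0 ≤ θ) (hc : 0 ≤ c) (hQ0 : ∀ u v, 0 ≤ Q u v)
    (hP₁0 : ∀ u v, 0 ≤ P₁ u v)
    (hconv : ∀ (b : B) (u v : X),
      ∑ y ∈ univ.filter (fun u => blk u = b), (1 : ℝ) * (Q u y * Q y v) ≤ θ * Q u v)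
    (hconv₁ : ∀ (b : B) (u v : X),
      ∑ y ∈ univ.filter (fun u => blk u = b), (1 : ℝ) * (P₁ u y * Q y v) ≤ θ * P₁ u v)
    (hd0 : ∀ u v, 0 ≤ d u v) (hsymm : ∀ u v, d u v = d v u) (htri : ∀ u v t, d u t ≤ d u v + d v t)
    (hrad : ∀ u, d u (ctr (blk u)) ≤ r) {K : ℝ}
    (hK : ∀ b : B, ∑ b', Real.exp (-(c / 2) * d (ctr b) (ctr b')) ≤ K)
    (A : Matrix X X E) (H G : Z → Matrix X X E)
    (hsum : ∀ x y, Summable fun n => (Gstar H G * Kop A H G ^ n) x y)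
    {C₁ M₀ : ℝ} (hC₁ : 0 ≤ C₁) (hM₀ : 0 < M₀)
    (hR : ∀ z u v, ‖linkR A H G z u v‖ ≤ C₁ / M₀ * (Q u v * Real.exp (-(c * d u v))))
    (hadj : ∀ z z', ¬ adj z z' → H z * Kz A H z' = 0) {ν : ℕ}
    (hadjcard : ∀ z, (univ.filter fun z' => adj z z').card ≤ ν)
    (hlarge : 2 * ((ν : ℝ) * (C₁ * θ * K * Real.exp (2 * c * r))) ≤ M₀)
    (D : Matrix X X E) {C₀' : ℝ} (hC₀' : 0 ≤ C₀')
    (h0' : ∀ z u v, ‖(D * link0 H G z) u v‖ ≤ C₀' * (P₁ u v * Real.exp (-(c * d u v))))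
    {ν₀ : ℕ} (S₀' : X → Finset Z) (hS₀' : ∀ x, ∀ z ∉ S₀' x, ∀ v, (D * link0 H G z) x v = 0)
    (hS₀'card : ∀ x, (S₀' x).card ≤ ν₀) :
    (∀ x y, Summable fun n => (D * (Gstar H G * Kop A H G ^ n)) x y) ∧
    (∀ x y, (D * walkExpansion A H G) x y = ∑' n, (D * (Gstar H G * Kop A H G ^ n)) x y) ∧
    ∀ x y, ‖(D * walkExpansion A H G) x y‖
      ≤ 2 * ν₀ * (C₀' * Real.exp (3 * c * r)) * (P₁ x y * Real.exp (-(c / 2) * d x y)) := by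
  have hK0 : ∀ x : X, 0 ≤ K := fun x => (sum_nonneg fun b' _ => (Real.exp_pos _).le).trans (hK (blk x))
  set q : ℝ := C₁ * θ * K * Real.exp (2 * c * r) / M₀ with hq
  have hν : (0 : ℝ) ≤ ν := Nat.cast_nonneg ν
  have hν₀ : (0 : ℝ) ≤ ν₀ := Nat.cast_nonneg ν₀
  have hνq : ∀ x : X, 0 ≤ (ν : ℝ) * q ∧ (ν : ℝ) * q ≤ 1 / 2 := by
    intro x
    have hK0' := hK0 x
    refine ⟨by positivity, ?_⟩
    rw [hq, ← mul_div_assoc, div_le_iff₀ hM₀]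
    linarith
  -- (196) per `n`, with the path count
  have hterm : ∀ n x y, ‖(D * (Gstar H G * Kop A H G ^ n)) x y‖
      ≤ (ν₀ : ℝ) * (C₀' * Real.exp (3 * c * r)) * (P₁ x y * Real.exp (-(c / 2) * d x y)) * ((ν : ℝ) * q) ^ n := by
    intro n x y
    have h := norm_dm_mul_gstar_mul_kop_pow_apply_le adj hθ hc hQ0 hP₁0 hconv hconv₁ hd0 hsymm htri hrad hK D A H G
      hC₀' hC₁ hM₀ h0' hR hadj hadjcard S₀' hS₀' hS₀'card n x y
    refine h.trans (le_of_eq ?_)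
    rw [mul_pow]
    ring
  have hsumNorm : ∀ x y, Summable fun n => ‖(D * (Gstar H G * Kop A H G ^ n)) x y‖ := by
    intro x y
    obtain ⟨h0q, hq2⟩ := hνq x
    exact Summable.of_nonneg_of_le (fun n => norm_nonneg _) (fun n => hterm n x y)
      ((summable_geometric_of_lt_one h0q (hq2.trans_lt (by norm_num))).mul_left _)
  have hsumD : ∀ x y, Summable fun n => (D * (Gstar H G * Kop A H G ^ n)) x y :=
    fun x y => (hsumNorm x y).of_norm
  have happly : ∀ x y, (D * walkExpansion A H G) x y = ∑' n, (D * (Gstar H G * Kop A H G ^ n)) x y :=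
    fun x y => dm_mul_walkExpansion_apply D A H G hsum x y
  refine ⟨hsumD, happly, fun x y => ?_⟩
  rw [happly x y]
  obtain ⟨h0q, hq2⟩ := hνq x
  have hΦ : 0 ≤ (ν₀ : ℝ) * (C₀' * Real.exp (3 * c * r)) * (P₁ x y * Real.exp (-(c / 2) * d x y)) :=
    mul_nonneg (mul_nonneg hν₀ (mul_nonneg hC₀' (Real.exp_pos _).le))
      (mul_nonneg (hP₁0 x y) (Real.exp_pos _).le)
  refine (norm_tsum_le_tsum_norm (hsumNorm x y)).trans ?_
  refine Real.tsum_le_of_sum_range_le (fun n => norm_nonneg _) fun N => ?_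
  calc ∑ n ∈ range N, ‖(D * (Gstar H G * Kop A H G ^ n)) x y‖
      ≤ ∑ n ∈ range N, (ν₀ : ℝ) * (C₀' * Real.exp (3 * c * r)) * (P₁ x y * Real.exp (-(c / 2) * d x y))
          * ((ν : ℝ) * q) ^ n := sum_le_sum fun n _ => hterm n x y
    _ = (ν₀ : ℝ) * (C₀' * Real.exp (3 * c * r)) * (P₁ x y * Real.exp (-(c / 2) * d x y))
          * ∑ n ∈ range N, ((ν : ℝ) * q) ^ n := by rw [mul_sum]
    _ ≤ (ν₀ : ℝ) * (C₀' * Real.exp (3 * c * r)) * (P₁ x y * Real.exp (-(c / 2) * d x y))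
          * ∑ n ∈ range N, (1 / 2 : ℝ) ^ n :=
        mul_le_mul_of_nonneg_left (sum_le_sum fun n _ => pow_le_pow_left₀ h0q hq2 n) hΦ
    _ ≤ (ν₀ : ℝ) * (C₀' * Real.exp (3 * c * r)) * (P₁ x y * Real.exp (-(c / 2) * d x y)) * 2 :=
        mul_le_mul_of_nonneg_left (sum_geometric_two_le N) hΦ
    _ = 2 * ν₀ * (C₀' * Real.exp (3 * c * r)) * (P₁ x y * Real.exp (-(c / 2) * d x y)) := by ring

end Derived

/-! ## §3 The forward lattice difference as a site matrix -/

section RowDiff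

variable {X : Type*} [Fintype X] [DecidableEq X] {E : Type*} [Ring E] [Algebra ℝ E]

/-- **`∂_μ` as left multiplication**: for any shift `s : X → X` (`x ↦ x + e_μ`) and factor `κ` (`η^{−1}`) there is a site
matrix `D` with `(D·M)(x,y) = κ(M(s x,y) − M(x,y))` for every `M` — so `∂G_{k,Λ} = D·G_{k,Λ}` entry by entry (`∂` on the
left variable of the kernel). [cite: Dimock2004QED3TorusII, §3.3 (196) p.30 L6–13 («∂G_{k,Λ}(x,y)»)] -/
theorem exists_rowDiff_matrix (s : X → X) (κ : ℝ) :
    ∃ D : Matrix X X E, ∀ (M : Matrix X X E) (x y : X), (D * M) x y = κ • (M (s x) y - M x y) := by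
  refine ⟨Matrix.of fun x w => κ • ((if w = s x then (1 : E) else 0) - (if w = x then 1 else 0)), fun M x y => ?_⟩
  rw [Matrix.mul_apply]
  simp only [Matrix.of_apply, smul_mul_assoc, sub_mul, ite_mul, one_mul, zero_mul, ← Finset.smul_sum,
    Finset.sum_sub_distrib, Finset.sum_ite_eq', Finset.mem_univ, if_true]

end RowDiff

/-! ## §4 On the torus: the differentiated first link from (145) and LEMMA 3 (198) -/

section FirstLink

variable {X : Type*} [Fintype X] [DecidableEq X]
variable {E : Type*} [NormedRing E] [NormedAlgebra ℝ E] [NormOneClass E]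
variable {Ns Nb Nc M₀ ℓb : ℕ} [NeZero Ns] [NeZero Nb] [NeZero Nc] [NeZero M₀] [NeZero ℓb]

omit [NeZero Nc] in
/-- **The differentiated first link `∂_μ(h_□G*_□h_□)` ON THE TORUS, from (145) and LEMMA 3 (198).**  With `h_w :=` the
periodized (124) (`ℓ = ℓ_bM₀` sites per cube side, window `ℓ(|t| + 3∕5) + ℓ_b + 2 < N_s∕2`), `e(x + e_μ) = e x + e_μ` on the site
torus, the value bound (198) (constant `C₀`) and the forward-gradient bound (198) (constant `C₀′`) for `G*_□ = G_w`:
`‖η^{−1}((h_wG_wh_w)(x + e_μ,v) − (h_wG_wh_w)(x,v))‖ ≤ (4e^{6c}GC₀(ηℓ)^{−1} + C₀′)·η³(d′_T^{−1} + d′_T^{−2})(e x,e v)e^{−c·d(Δ_x,Δ_v)}` —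
the lattice product rule `h(x′)G(x′,v)h(v) − h(x)G(x,v)h(v) = [(h(x′) − h(x))G(x′,v) + h(x)(G(x′,v) − G(x,v))]h(v)` with
`|h| ≤ 1`, «`∂h_□ = O(ℓ^{−1})`» ((145) on the torus) and hop comparability of the profile across one lattice step.
[cite: Dimock2004QED3TorusII, §3.3 Lemma 3 (198) p.30 L19–22, Thm 2 (196) p.30 L6–13, proof (199) p.30 L24–31; §3.2 (145) p.23 L66–69] -/
theorem norm_fwdDiff_link0_le {c η t Gg C₀ C₀' : ℝ} (hmodS : Ns = ℓb * Nb) (e : X → TPt 3 Ns)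
    (β : X → TPt 3 Nb) (hβ : ∀ x, β x = czmap ℓb Nb (e x)) (hη : 0 < η) (hc : 0 ≤ c)
    (hGg : ∀ z : Fin 3 → ℝ, ‖fderiv ℝ (g : (Fin 3 → ℝ) → ℝ) z‖ ≤ Gg)
    (hwin : (((ℓb * M₀ : ℕ)) : ℝ) * (|t| + 3 / 5) + ℓb + 2 < (Ns : ℝ) / 2)
    (cz : TPt 3 Nc → TPt 3 Ns) (H : TPt 3 Nc → Matrix X X E)
    (hH : ∀ w, H w = Matrix.diagonal fun x =>
      algebraMap ℝ E (g (fun i => (((ℓb * M₀ : ℕ) : ℝ))⁻¹ * (((e x - cz w) i).valMinAbs : ℝ) - t)))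
    (nbp : Fin 3 → X → X) (hnbp : ∀ μ x, e (nbp μ x) = e x + proj Ns (Pi.single μ 1))
    (G : TPt 3 Nc → Matrix X X E) (hC₀ : 0 ≤ C₀)
    (h198a : ∀ w u v, ‖G w u v‖ ≤ C₀ * ((η ^ 3 * (η * dOne (vmaVec (e u - e v))) ^ (-(1 : ℝ)))
      * Real.exp (-(c * torusDist (β u) (β v)))))
    (h198b : ∀ w x μ v, ‖G w (nbp μ x) v - G w x v‖ ≤ C₀' * (η * ((η ^ 3 *
      ((η * dOne (vmaVec (e x - e v))) ^ (-(1 : ℝ)) + (η * dOne (vmaVec (e x - e v))) ^ (-(2 : ℝ))))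
        * Real.exp (-(c * torusDist (β x) (β v))))))
    (w : TPt 3 Nc) (μ : Fin 3) (x v : X) :
    ‖η⁻¹ • (link0 H G w (nbp μ x) v - link0 H G w x v)‖
      ≤ (4 * Real.exp (c * 6) * Gg * C₀ * (η * ((ℓb * M₀ : ℕ) : ℝ))⁻¹ + C₀')
        * ((η ^ 3 * ((η * dOne (vmaVec (e x - e v))) ^ (-(1 : ℝ)) + (η * dOne (vmaVec (e x - e v))) ^ (-(2 : ℝ))))
          * Real.exp (-(c * torusDist (β x) (β v)))) := by
  haveI : NeZero (ℓb * M₀) := ⟨Nat.mul_ne_zero (NeZero.ne ℓb) (NeZero.ne M₀)⟩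
  have hℓb : 0 < ℓb := Nat.pos_of_ne_zero (NeZero.ne ℓb)
  have hℓbr : (0 : ℝ) ≤ ℓb := Nat.cast_nonneg ℓb
  have hℓpos : (0 : ℝ) < ((ℓb * M₀ : ℕ) : ℝ) := by
    exact_mod_cast Nat.pos_of_ne_zero (Nat.mul_ne_zero (NeZero.ne ℓb) (NeZero.ne M₀))
  have hGg0 : 0 ≤ Gg := (norm_nonneg _).trans (hGg 0)
  -- abbreviations: the bump, the two profiles at `x`
  set f : X → ℝ := fun y => g (fun i => (((ℓb * M₀ : ℕ) : ℝ))⁻¹ * (((e y - cz w) i).valMinAbs : ℝ) - t) with hf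
  set Φ₁ : ℝ := (η ^ 3 * (η * dOne (vmaVec (e x - e v))) ^ (-(1 : ℝ)))
    * Real.exp (-(c * torusDist (β x) (β v))) with hΦ₁
  set Φ : ℝ := (η ^ 3 * ((η * dOne (vmaVec (e x - e v))) ^ (-(1 : ℝ))
    + (η * dOne (vmaVec (e x - e v))) ^ (-(2 : ℝ)))) * Real.exp (-(c * torusDist (β x) (β v))) with hΦ
  have hd : ∀ y, 0 < η * dOne (vmaVec (e y - e v)) := fun y => dprimeT_pos hη (e y) (e v)
  have hη3 : 0 ≤ η ^ 3 := pow_nonneg hη.le 3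
  have hex : 0 ≤ Real.exp (-(c * torusDist (β x) (β v))) := (Real.exp_pos _).le
  have p1 : 0 ≤ (η * dOne (vmaVec (e x - e v))) ^ (-(1 : ℝ)) := Real.rpow_nonneg (hd x).le _
  have p2 : 0 ≤ (η * dOne (vmaVec (e x - e v))) ^ (-(2 : ℝ)) := Real.rpow_nonneg (hd x).le _
  have hΦ0 : 0 ≤ Φ := mul_nonneg (mul_nonneg hη3 (add_nonneg p1 p2)) hex
  have hΦ₁Φ : Φ₁ ≤ Φ := by
    have hsplit : Φ = Φ₁ + (η ^ 3 * (η * dOne (vmaVec (e x - e v))) ^ (-(2 : ℝ)))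
        * Real.exp (-(c * torusDist (β x) (β v))) := by
      simp only [hΦ, hΦ₁]
      ring
    rw [hsplit]
    linarith [mul_nonneg (mul_nonneg hη3 p2) hex]
  -- the entries of the first link and the product rule
  have happ : ∀ y, link0 H G w y v = algebraMap ℝ E (f y) * G w y v * algebraMap ℝ E (f v) := by
    intro y
    have h := link0_apply (φ := fun w x => algebraMap ℝ E
      (g (fun i => (((ℓb * M₀ : ℕ) : ℝ))⁻¹ * (((e x - cz w) i).valMinAbs : ℝ) - t))) hH G w y v
    beta_reduce at h
    exact h
  have hdiff : link0 H G w (nbp μ x) v - link0 H G w x v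
      = ((f (nbp μ x) - f x) • G w (nbp μ x) v + f x • (G w (nbp μ x) v - G w x v)) * algebraMap ℝ E (f v) := by
    rw [happ, happ, Algebra.smul_def, Algebra.smul_def, map_sub]
    noncomm_ring
  have hf1 : ∀ y, |f y| ≤ 1 := fun y =>
    abs_le.2 ⟨by linarith [g_nonneg (fun i => (((ℓb * M₀ : ℕ) : ℝ))⁻¹ * (((e y - cz w) i).valMinAbs : ℝ) - t)],
      g_le_one _⟩
  have hφ1 : ∀ y, ‖algebraMap ℝ E (f y)‖ ≤ 1 := fun y => by
    rw [norm_algebraMap', Real.norm_eq_abs]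
    exact hf1 y
  -- one lattice step: «∂h_□ = O(ℓ⁻¹)» ((145) on the torus)
  have hδbox : (Pi.single μ 1 : Pt 3) ∈ box 3 1 :=
    mem_box.2 fun i => by by_cases hi : i = μ <;> simp [hi]
  have hnbp1 : e (nbp μ x) ∈ tball (e x) 1 := mem_tball.2 ⟨_, hδbox, hnbp μ x⟩
  have hstep : |f (nbp μ x) - f x| ≤ Gg * (((ℓb * M₀ : ℕ) : ℝ))⁻¹ := by
    have h := abs_sub_g_torus_le (ℓ := ℓb * M₀) (Nc := Nc) (t := t) hGg (s := 1)
      (by have hw := hwin; push_cast at hw ⊢; nlinarith) cz w hnbp1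
    rw [abs_sub_comm, Nat.cast_one, mul_one] at h
    exact h
  -- hop comparability: the value bound (198) at `x + e_μ` against the profile at `x`
  have hβy : β (nbp μ x) ∈ tball (β x) 2 := by
    have h1 := czmap_mem_tball (Ls := ℓb) (Nc := Nb) hmodS hnbp1
    rw [← hβ, ← hβ] at h1
    exact tball_mono (by have := Nat.div_le_self 1 ℓb; omega) h1
  have hdist : torusDist (β x) (β v) - 6 ≤ torusDist (β (nbp μ x)) (β v) := by
    have h1 := torusDist_le_of_mem_tball hβy
    have h2 := torusDist_triangle (β x) (β (nbp μ x)) (β v)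
    norm_num at h1
    linarith
  have hd1 : dOne (vmaVec (e x - e (nbp μ x))) ≤ (1 : ℕ) := dOne_vmaVec_sub_le_of_mem_tball hnbp1 le_rfl
  rw [Nat.cast_one] at hd1
  have htri := dprimeT_triangle hη.le (e x) (e (nbp μ x)) (e v)
  have hone := one_le_dOne (vmaVec (e (nbp μ x) - e v))
  have hxy : η * dOne (vmaVec (e x - e (nbp μ x))) ≤ η * 1 := mul_le_mul_of_nonneg_left hd1 hη.le
  have hyv : η * 1 ≤ η * dOne (vmaVec (e (nbp μ x) - e v)) := mul_le_mul_of_nonneg_left hone hη.le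
  have hab : η * dOne (vmaVec (e x - e v)) ≤ 2 * (η * dOne (vmaVec (e (nbp μ x) - e v))) := by linarith
  have r1 := rpow_neg_one_le_two_mul (hd (nbp μ x)) (hd x) hab
  have hP1 : η ^ 3 * (η * dOne (vmaVec (e (nbp μ x) - e v))) ^ (-(1 : ℝ))
      ≤ 4 * (η ^ 3 * (η * dOne (vmaVec (e x - e v))) ^ (-(1 : ℝ))) := by
    calc η ^ 3 * (η * dOne (vmaVec (e (nbp μ x) - e v))) ^ (-(1 : ℝ))
        ≤ η ^ 3 * (2 * (η * dOne (vmaVec (e x - e v))) ^ (-(1 : ℝ))) := mul_le_mul_of_nonneg_left r1 hη3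
      _ = 4 * (η ^ 3 * (η * dOne (vmaVec (e x - e v))) ^ (-(1 : ℝ)))
          - 2 * (η ^ 3 * (η * dOne (vmaVec (e x - e v))) ^ (-(1 : ℝ))) := by ring
      _ ≤ _ := by linarith [mul_nonneg hη3 p1]
  have hGval : ‖G w (nbp μ x) v‖ ≤ C₀ * (4 * Real.exp (c * 6) * Φ₁) := by
    have hprof := profile_hop_le (P := fun u v => η ^ 3 * (η * dOne (vmaVec (e u - e v))) ^ (-(1 : ℝ)))
      (d := fun u v => torusDist (β u) (β v)) (c := c) (δ := 6) hc
      (fun u v => mul_nonneg (pow_nonneg hη.le 3) (Real.rpow_nonneg (dprimeT_pos hη (e u) (e v)).le _))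
      (x := x) (x' := nbp μ x) (y := v) hP1 hdist
    exact (h198a w (nbp μ x) v).trans (mul_le_mul_of_nonneg_left hprof hC₀)
  have hgrad : ‖G w (nbp μ x) v - G w x v‖ ≤ C₀' * (η * Φ) := h198b w x μ v
  -- assemble
  rw [hdiff, norm_smul, Real.norm_eq_abs, abs_of_pos (inv_pos.2 hη)]
  have hn : ‖((f (nbp μ x) - f x) • G w (nbp μ x) v + f x • (G w (nbp μ x) v - G w x v)) * algebraMap ℝ E (f v)‖
      ≤ Gg * (((ℓb * M₀ : ℕ) : ℝ))⁻¹ * (C₀ * (4 * Real.exp (c * 6) * Φ₁)) + 1 * (C₀' * (η * Φ)) := by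
    refine (norm_mul_le _ _).trans ?_
    refine (mul_le_mul_of_nonneg_left (hφ1 v) (norm_nonneg _)).trans ?_
    rw [mul_one]
    refine (norm_add_le _ _).trans (add_le_add ?_ ?_)
    · rw [norm_smul, Real.norm_eq_abs]
      exact mul_le_mul hstep hGval (norm_nonneg _) (mul_nonneg hGg0 (inv_nonneg.2 hℓpos.le))
    · rw [norm_smul, Real.norm_eq_abs]
      exact mul_le_mul (hf1 x) hgrad (norm_nonneg _) zero_le_one
  refine (mul_le_mul_of_nonneg_left hn (inv_pos.2 hη).le).trans ?_
  have hcoef : 0 ≤ 4 * Real.exp (c * 6) * Gg * C₀ * (η * ((ℓb * M₀ : ℕ) : ℝ))⁻¹ := by positivity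
  calc η⁻¹ * (Gg * (((ℓb * M₀ : ℕ) : ℝ))⁻¹ * (C₀ * (4 * Real.exp (c * 6) * Φ₁)) + 1 * (C₀' * (η * Φ)))
      = 4 * Real.exp (c * 6) * Gg * C₀ * (η⁻¹ * (((ℓb * M₀ : ℕ) : ℝ))⁻¹) * Φ₁ + C₀' * (η⁻¹ * η) * Φ := by ring
    _ = 4 * Real.exp (c * 6) * Gg * C₀ * (η * ((ℓb * M₀ : ℕ) : ℝ))⁻¹ * Φ₁ + C₀' * Φ := by
        rw [inv_mul_cancel₀ hη.ne', mul_one, ← mul_inv]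
    _ ≤ 4 * Real.exp (c * 6) * Gg * C₀ * (η * ((ℓb * M₀ : ℕ) : ℝ))⁻¹ * Φ + C₀' * Φ :=
        add_le_add (mul_le_mul_of_nonneg_left hΦ₁Φ hcoef) le_rfl
    _ = (4 * Real.exp (c * 6) * Gg * C₀ * (η * ((ℓb * M₀ : ℕ) : ℝ))⁻¹ + C₀') * Φ := by ring

end FirstLink

/-! ## §5 THEOREM 2 (196), single scale, on the 3-torus — from LEMMA 3 alone -/

section Theorem2Deriv

variable {d : ℕ} {Nb Nc M₀ : ℕ} [NeZero Nb] [NeZero Nc] [NeZero M₀]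
variable {X : Type*} [Fintype X] [DecidableEq X] {E : Type*} [NormedRing E] [NormedAlgebra ℝ E]
variable {Z : Type*} [Fintype Z] [DecidableEq Z]

/-- **(196) summed, single scale, ON THE TORUS — the geometry discharged.**  Data as in `dimock_thm1_torus` (sites `X` with
unit blocks `Δ : X → (ℤ∕N_b)^d`, cubes `Z` in the cube torus `(ℤ∕N_c)^d`, `N_b = M₀N_c`, anchors, `H □ = diagonal(h_□)` with
`supp h_□ ⊂ anc(□)^{∼R}`, `A(x,y) ≠ 0 ⟹ Δ_y ∈ Δ_x^{∼ρ}`, `2R + ρ < 2M₀`), the entrywise convergence of the walk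
expansion, the later-link bound ((201)-shape, profile `Q`), a DERIVATIVE matrix `D` acting as `κ(M(s x,·) − M(x,·))` for a
shift `s` and the differentiated first-link bound (profile `P₁`), the block convolution bounds for `(Q,Q)` and `(P₁,Q)` over
the unit blocks, and *"`M_0` sufficiently large"* = `2·3^d·C₁θK₁(d,c∕2) ≤ M₀` (the same number as for (195)).  THEN
`(D·G_k)(x,y) = Σ'_n(D·S*Rⁿ)(x,y)` and **(196)** `‖(D·G_k)(x,y)‖ ≤ 4·3^d·C₀′·P₁(x,y)e^{−(c∕2)d(Δ_x,Δ_y)}` — by `dimock_thm2_deriv`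
with `adj □ □′ := cidx □′ ∈ (cidx □)^{∼1}` (`ν = 3^d`), start cubes of the differentiated first link = those of `x` and of
`s x` (`ν₀ = 2·3^d`, `link0_eq_zero_of_far_torus`), `K := K₁(d,c∕2)`, `r = 0`.
[cite: Dimock2004QED3TorusII, §3.3 Thm 2 (196) p.30 L6–13, proof p.31 L6–12; §3.2 Remark 3 p.22 L28–30, (132) p.22 L2–11, proof Part III p.24 L59 – p.25 L12] -/
theorem dimock_thm2_deriv_torus [CompleteSpace E] {θ c : ℝ} {P₁ Q : X → X → ℝ}
    (hmod : Nb = M₀ * Nc) (β : X → TPt d Nb) (ctr : TPt d Nb → X) (hctr : ∀ b, β (ctr b) = b)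
    (cidx : Z → TPt d Nc) (hcidx : Function.Injective cidx) (c₀ : Pt d) (hc₀ : ∀ i, 0 ≤ c₀ i ∧ c₀ i < M₀)
    (anc : TPt d Nc → TPt d Nb) (hanc : ∀ w, anc w = proj Nb fun i => (M₀ : ℤ) * natLift w i + c₀ i)
    (hθ : 0 ≤ θ) (hc : 0 < c) (hQ0 : ∀ u v, 0 ≤ Q u v) (hP₁0 : ∀ u v, 0 ≤ P₁ u v)
    (hconv : ∀ (b : TPt d Nb) (u v : X),
      ∑ y ∈ univ.filter (fun u => β u = b), (1 : ℝ) * (Q u y * Q y v) ≤ θ * Q u v)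
    (hconv₁ : ∀ (b : TPt d Nb) (u v : X),
      ∑ y ∈ univ.filter (fun u => β u = b), (1 : ℝ) * (P₁ u y * Q y v) ≤ θ * P₁ u v)
    (φ : Z → X → E) (H : Z → Matrix X X E) (hH : ∀ z, H z = Matrix.diagonal (φ z)) {Rb ρb : ℕ}
    (hφ : ∀ z x, φ z x ≠ 0 → β x ∈ tball (anc (cidx z)) Rb)
    (A : Matrix X X E) (hA : ∀ x y, A x y ≠ 0 → β y ∈ tball (β x) ρb)
    (hRρ : 2 * Rb + ρb < 2 * M₀)
    (G : Z → Matrix X X E) (hsum : ∀ x y, Summable fun n => (Gstar H G * Kop A H G ^ n) x y)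
    {C₁ : ℝ} (hC₁ : 0 ≤ C₁)
    (hR : ∀ z u v, ‖linkR A H G z u v‖
      ≤ C₁ / (M₀ : ℝ) * (Q u v * Real.exp (-(c * torusDist (β u) (β v)))))
    (hlarge : 2 * (((3 ^ d : ℕ) : ℝ) * (C₁ * θ * K₁ d (c / 2))) ≤ (M₀ : ℝ))
    (D : Matrix X X E) (s : X → X) (κ : ℝ)
    (hD : ∀ (M : Matrix X X E) (x y : X), (D * M) x y = κ • (M (s x) y - M x y))
    {C₀' : ℝ} (hC₀' : 0 ≤ C₀')
    (h0' : ∀ z u v, ‖(D * link0 H G z) u v‖ ≤ C₀' * (P₁ u v * Real.exp (-(c * torusDist (β u) (β v))))) :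
    (∀ x y, (D * walkExpansion A H G) x y = ∑' n, (D * (Gstar H G * Kop A H G ^ n)) x y) ∧
    ∀ x y, ‖(D * walkExpansion A H G) x y‖
      ≤ 4 * ((3 ^ d : ℕ) : ℝ) * C₀' * (P₁ x y * Real.exp (-(c / 2) * torusDist (β x) (β y))) := by
  classical
  have hM₀ : 0 < M₀ := Nat.pos_of_ne_zero (NeZero.ne M₀)
  have hM₀r : (0 : ℝ) < M₀ := by exact_mod_cast hM₀
  have hRM : Rb < M₀ := by omega
  -- the start cubes of a site: those within 1 of the cube of its block
  let S : X → Finset Z := fun x => univ.filter fun z => cidx z ∈ tball (czmap M₀ Nc (β x)) 1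
  have hSfar : ∀ x, ∀ z ∉ S x, cidx z ∉ tball (czmap M₀ Nc (β x)) 1 :=
    fun x z hz hmem => hz (mem_filter.2 ⟨mem_univ _, hmem⟩)
  have hScard : ∀ x, (S x).card ≤ 3 ^ d := by
    intro x
    have h := card_filter_mem_tball_le cidx hcidx (czmap M₀ Nc (β x)) 1
    have h3 : (2 * 1 + 1) ^ d = 3 ^ d := by norm_num
    omega
  have hadjcard : ∀ z, (univ.filter fun z' => cidx z' ∈ tball (cidx z) 1).card ≤ 3 ^ d := by
    intro z
    have h := card_filter_mem_tball_le cidx hcidx (cidx z) 1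
    have h3 : (2 * 1 + 1) ^ d = 3 ^ d := by norm_num
    omega
  -- the start cubes of the differentiated first link at `x`: those of `x` and of `s x`
  let S' : X → Finset Z := fun x => S x ∪ S (s x)
  have hS'card : ∀ x, (S' x).card ≤ 2 * 3 ^ d := by
    intro x
    have h1 := hScard x
    have h2 := hScard (s x)
    exact (card_union_le _ _).trans (by omega)
  have hS' : ∀ x, ∀ z ∉ S' x, ∀ v, (D * link0 H G z) x v = 0 := by
    intro x z hz v
    have hz' : z ∉ S x ∧ z ∉ S (s x) := not_or.1 (mt mem_union.2 hz)
    rw [hD, link0_eq_zero_of_far_torus hH hmod hc₀ hanc hφ hRM G (hSfar (s x) z hz'.2) v,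
      link0_eq_zero_of_far_torus hH hmod hc₀ hanc hφ hRM G (hSfar x z hz'.1) v, sub_zero, smul_zero]
  have hlarge' : 2 * (((3 ^ d : ℕ) : ℝ) * (C₁ * θ * K₁ d (c / 2) * Real.exp (2 * c * 0))) ≤ (M₀ : ℝ) := by
    rw [mul_zero, Real.exp_zero, mul_one]
    exact hlarge
  obtain ⟨-, h2, h3⟩ := dimock_thm2_deriv (fun z z' => cidx z' ∈ tball (cidx z) 1)
    (d := fun u v => torusDist (β u) (β v)) (ctr := ctr) (r := 0) (blk := β)
    hθ hc.le hQ0 hP₁0 hconv hconv₁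
    (fun u v => torusDist_nonneg _ _) (fun u v => torusDist_comm' _ _) (fun u v t => torusDist_triangle _ _ _)
    (fun u => by
      show torusDist (β u) (β (ctr (β u))) ≤ 0
      rw [hctr, torusDist_self'])
    (K := K₁ d (c / 2))
    (fun b => by
      show ∑ b', Real.exp (-(c / 2) * torusDist (β (ctr b)) (β (ctr b'))) ≤ K₁ d (c / 2)
      simp_rw [hctr]
      exact sum_exp_torusDist_le (half_pos hc) b)
    A H G hsum hC₁ hM₀r hR
    (fun z z' hzz' => H_mul_Kz_eq_zero_of_far_torus hH hmod hanc hφ hA hRρ hzz')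
    hadjcard hlarge' D hC₀' h0' S' hS' hS'card
  refine ⟨h2, fun x y => ?_⟩
  have h := h3 x y
  rw [mul_zero, Real.exp_zero, mul_one] at h
  refine h.trans (le_of_eq ?_)
  push_cast
  ring

variable [NormOneClass E]

open Balaban1983to89.B12Decay510Torus (vmaVec)

/-- **THEOREM 2 (194)–(196), single scale, on the 3-torus, with `h_□ :=` the printed (124) periodized, FROM LEMMA 3 ALONE.**
Hypotheses EXACTLY those of the tree's `dimock_thm2_torus_lemma3` (the site torus `(ℤ∕N_s)³` with unit blocks of `ℓ_b`
sites and cubes of `M₀` blocks, the lattice structure `x ↦ x ± e_μ`, the operator `A` with off-diagonal entries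
`A_Δ + A_Q` — `A_Δ` acting as `−Δ` at spacing `η`, `A_Q` the block average of sup `a_Q` ((197)); LEMMA 3: (197) as
`h_□AG*_□ = h_□` and (198) value AND forward-gradient bounds; the window ∕ size conditions; *"Let `M_0` be sufficiently
large"* with the explicit constant).  Conclusions: the expansion (199) converges entrywise, `A·G_k = 1`, (195), AND
**(196)** for the forward lattice derivative in the left variable:
`‖η^{−1}(G_k(x + e_μ,y) − G_k(x,y))‖ ≤ 4·3³·(4e^{6c}GC₀(ηℓ)^{−1} + C₀′)·η³(d′_T^{−1} + d′_T^{−2})(e x,e y)e^{−(c∕2)d(Δ_x,Δ_y)}`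
— «the last step (204)» at unit blocks is (202): `hconv_shape_torus_boson` BY NAME for both block bounds; the
differentiated first link by `norm_fwdDiff_link0_le`; (201) by `eq201_torus`.
[cite: Dimock2004QED3TorusII, §3.3 Thm 2 (194)–(196) p.30 L1–13, Lemma 3 (197)–(198) p.30 L14–22, proof (199)–(204) p.30 L24 – p.31 L12; §3.1 (124)–(126) p.20 L82 – p.21 L15] -/
theorem dimock_thm2_deriv_torus_lemma3 [CompleteSpace E] {c η t Gg aQ C₀ C₀' : ℝ} {G₂ : ℝ≥0} {Ns ℓb R r : ℕ} {τ : ℤ}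
    [NeZero Ns] [NeZero ℓb]
    (hmod : Nb = M₀ * Nc) (hmodS : Ns = ℓb * Nb) (hNc : 2 * |t| + 6 / 5 < (Nc : ℝ))
    (e : X → TPt 3 Ns) (he : Function.Injective e)
    (β : X → TPt 3 Nb) (hβ : ∀ x, β x = czmap ℓb Nb (e x)) (ctr : TPt 3 Nb → X) (hctr : ∀ b, β (ctr b) = b)
    (hblk : ∀ b, (univ.filter fun u => β u = b).card ≤ R ^ 3) (hR : 1 ≤ R) (hη : 0 < η) (hc : 0 < c)
    (hGg : ∀ z : Fin 3 → ℝ, ‖fderiv ℝ (g : (Fin 3 → ℝ) → ℝ) z‖ ≤ Gg)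
    (hG₂ : LipschitzWith G₂ (fderiv ℝ (g : (Fin 3 → ℝ) → ℝ)))
    {cz : TPt 3 Nc → TPt 3 Ns} (hcz : ∀ w, cz w = proj Ns fun i => ((ℓb * M₀ : ℕ) : ℤ) * natLift w i)
    (hτ0 : 0 ≤ τ) (hτℓ : τ < (ℓb * M₀ : ℕ)) (hτ : |((ℓb * M₀ : ℕ) : ℝ) * t - τ| ≤ 1 / 2)
    (hr : (3 / 5 : ℝ) * ((ℓb * M₀ : ℕ) : ℝ) + 1 / 2 ≤ r)
    (hwin : (((ℓb * M₀ : ℕ)) : ℝ) * (|t| + 3 / 5) + ℓb + 2 < (Ns : ℝ) / 2)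
    (H : TPt 3 Nc → Matrix X X E)
    (hH : ∀ w, H w = Matrix.diagonal fun x =>
      algebraMap ℝ E (g (fun i => (((ℓb * M₀ : ℕ) : ℝ))⁻¹ * (((e x - cz w) i).valMinAbs : ℝ) - t)))
    (nbp nbm : Fin 3 → X → X) (hnbp : ∀ μ x, e (nbp μ x) = e x + proj Ns (Pi.single μ 1))
    (hnbm : ∀ μ x, e (nbm μ x) = e x + proj Ns (-Pi.single μ 1))
    (A AD AQ : Matrix X X E) (hA : ∀ x u, x ≠ u → A x u = AD x u + AQ x u)
    (hAD : ∀ (S : X → E) (x : X), ∑ u, AD x u * S u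
      = (-(η⁻¹ ^ 2)) • ∑ μ, (S (nbp μ x) + S (nbm μ x) - (2 : ℝ) • S x))
    (hADr : ∀ x u, AD x u ≠ 0 → e u ∈ tball (e x) 1)
    (hAQ : ∀ x u, AQ x u ≠ 0 → β u = β x) (haQ : 0 ≤ aQ) (hAQn : ∀ x u, ‖AQ x u‖ ≤ aQ)
    (hRρ : 2 * (r / ℓb + 1) + 2 < 2 * M₀) (hRρ' : (r / ℓb + 1) + 2 < M₀)
    (G : TPt 3 Nc → Matrix X X E) (h136 : ∀ w, H w * A * G w = H w)
    (hC₀ : 0 ≤ C₀) (hC₀' : 0 ≤ C₀')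
    (h198a : ∀ w u v, ‖G w u v‖ ≤ C₀ * ((η ^ 3 * (η * dOne (vmaVec (e u - e v))) ^ (-(1 : ℝ)))
      * Real.exp (-(c * torusDist (β u) (β v)))))
    (h198b : ∀ w x μ v, ‖G w (nbp μ x) v - G w x v‖ ≤ C₀' * (η * ((η ^ 3 *
      ((η * dOne (vmaVec (e x - e v))) ^ (-(1 : ℝ)) + (η * dOne (vmaVec (e x - e v))) ^ (-(2 : ℝ))))
        * Real.exp (-(c * torusDist (β x) (β v))))))
    (hlarge : 2 * (((3 ^ 3 : ℕ) : ℝ) *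
        (((3 * Real.exp (c * 6) * (4 * G₂ * C₀ * ((η * ℓb) ^ 2)⁻¹ + 5 * Gg * C₀' * (η * ℓb)⁻¹)
            + Gg * aQ * C₀ * (2 * (η * R) ^ 3 + 2 * blockConst 1 * (η * R) ^ 2 * (η * ℓb)) / η ^ 3))
          * (2 ^ ((1 : ℝ) + 1) * blockConst 1 * (η * R) ^ ((3 : ℝ) - 1)
            + 2 * (Real.sqrt 8 * blockConst 2 * (η * R))
            + 2 ^ ((2 : ℝ) + 1) * blockConst 2 * (η * R) ^ ((3 : ℝ) - 2)) * K₁ 3 (c / 2))) ≤ (M₀ : ℝ)) :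
    (∀ x y, Summable fun n => (Gstar H G * Kop A H G ^ n) x y) ∧
    A * walkExpansion A H G = 1 ∧
    (∀ x y, ‖walkExpansion A H G x y‖
      ≤ 2 * ((3 ^ 3 : ℕ) : ℝ) * C₀ * ((η ^ 3 * (η * dOne (vmaVec (e x - e y))) ^ (-(1 : ℝ)))
          * Real.exp (-(c / 2) * torusDist (β x) (β y)))) ∧
    ∀ μ x y, ‖η⁻¹ • (walkExpansion A H G (nbp μ x) y - walkExpansion A H G x y)‖
      ≤ 4 * ((3 ^ 3 : ℕ) : ℝ) * (4 * Real.exp (c * 6) * Gg * C₀ * (η * ((ℓb * M₀ : ℕ) : ℝ))⁻¹ + C₀')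
          * ((η ^ 3 * ((η * dOne (vmaVec (e x - e y))) ^ (-(1 : ℝ)) + (η * dOne (vmaVec (e x - e y))) ^ (-(2 : ℝ))))
            * Real.exp (-(c / 2) * torusDist (β x) (β y))) := by
  obtain ⟨hsum, hinv, h195⟩ := dimock_thm2_torus_lemma3 hmod hmodS hNc e he β hβ ctr hctr hblk hR hη hc hGg hG₂ hcz
    hτ0 hτℓ hτ hr hwin H hH nbp nbm hnbp hnbm A AD AQ hA hAD hADr hAQ haQ hAQn hRρ hRρ' G h136 hC₀ hC₀' h198a h198b
    hlarge
  refine ⟨hsum, hinv, h195, fun μ x y => ?_⟩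
  have hℓ : NeZero (ℓb * M₀) := ⟨Nat.mul_ne_zero (NeZero.ne ℓb) (NeZero.ne M₀)⟩
  have hℓb : 0 < ℓb := Nat.pos_of_ne_zero (NeZero.ne ℓb)
  have hℓbz : (0 : ℤ) < ℓb := by exact_mod_cast hℓb
  have hGg0 : 0 ≤ Gg := (norm_nonneg _).trans (hGg 0)
  have hηR : 0 ≤ η * R := mul_nonneg hη.le (Nat.cast_nonneg R)
  have hC1 : 0 ≤ blockConst 1 := zero_le_one.trans (one_le_blockConst (α := 1) (by norm_num))
  have hC2 : 0 ≤ blockConst 2 := zero_le_one.trans (one_le_blockConst (α := 2) (by norm_num))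
  have hθ : 0 ≤ 2 ^ ((1 : ℝ) + 1) * blockConst 1 * (η * R) ^ ((3 : ℝ) - 1)
      + 2 * (Real.sqrt 8 * blockConst 2 * (η * R)) + 2 ^ ((2 : ℝ) + 1) * blockConst 2 * (η * R) ^ ((3 : ℝ) - 2) := by
    positivity
  have hC₁ : 0 ≤ (3 * Real.exp (c * 6) * (4 * G₂ * C₀ * ((η * ℓb) ^ 2)⁻¹ + 5 * Gg * C₀' * (η * ℓb)⁻¹)
      + Gg * aQ * C₀ * (2 * (η * R) ^ 3 + 2 * blockConst 1 * (η * R) ^ 2 * (η * ℓb)) / η ^ 3) := by positivity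
  have hQ0 : ∀ u v : X, 0 ≤ η ^ 3 * ((η * dOne (vmaVec (e u - e v))) ^ (-(1 : ℝ))
      + (η * dOne (vmaVec (e u - e v))) ^ (-(2 : ℝ))) := fun u v =>
    mul_nonneg (pow_nonneg hη.le 3) (add_nonneg (Real.rpow_nonneg (dprimeT_pos hη (e u) (e v)).le _)
      (Real.rpow_nonneg (dprimeT_pos hη (e u) (e v)).le _))
  -- the anchors: the blocks of the centre sites `cz w + τ`
  set anc : TPt 3 Nc → TPt 3 Nb := fun w => czmap ℓb Nb (cz w + proj Ns fun _ => τ) with hanc_def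
  have hanc : ∀ w, anc w = proj Nb fun i => (M₀ : ℤ) * natLift w i + (fun _ : Fin 3 => τ / ℓb) i :=
    fun w => czmap_centre_site (Nb := Nb) (M₀ := M₀) hmodS τ hcz w
  have hc₀ : ∀ i : Fin 3, 0 ≤ (fun _ : Fin 3 => τ / (ℓb : ℤ)) i ∧ (fun _ : Fin 3 => τ / (ℓb : ℤ)) i < M₀ := by
    intro i
    refine ⟨Int.ediv_nonneg hτ0 hℓbz.le, ?_⟩
    show τ / (ℓb : ℤ) < M₀
    rw [Int.ediv_lt_iff_lt_mul hℓbz]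
    have : ((ℓb * M₀ : ℕ) : ℤ) = (M₀ : ℤ) * ℓb := by push_cast; ring
    rw [← this]
    exact_mod_cast hτℓ
  -- the support of `h_w` at block level
  have hφ : ∀ w x, algebraMap ℝ E (g (fun i => (((ℓb * M₀ : ℕ) : ℝ))⁻¹ * (((e x - cz w) i).valMinAbs : ℝ) - t)) ≠ 0 →
      β x ∈ tball (anc w) (r / ℓb + 1) := by
    intro w x hx
    have hx' : g (fun i => (((ℓb * M₀ : ℕ) : ℝ))⁻¹ * (((e x - cz w) i).valMinAbs : ℝ) - t) ≠ 0 :=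
      fun h0 => hx (by rw [h0, map_zero])
    have h1 : e x ∈ tball (cz w + proj Ns fun _ => τ) r :=
      mem_tball_of_g_torus_ne_zero (ℓ := ℓb * M₀) hτ hr cz w (e x) hx'
    have h2 := czmap_mem_tball (Ls := ℓb) (Nc := Nb) hmodS h1
    rw [← hβ x] at h2
    exact h2
  -- the range of `A`: one block
  have hA' : ∀ x y, A x y ≠ 0 → β y ∈ tball (β x) (ℓb / ℓb + 1) := by
    intro x y hxy
    have hsite : e y ∈ tball (e x) ℓb := by
      by_cases hxy' : x = y
      · subst hxy'
        exact self_mem_tball _ _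
      · rw [hA x y hxy'] at hxy
        by_cases hDz : AD x y = 0
        · rw [hDz, zero_add] at hxy
          have h1 := mem_tball_of_czmap_eq (Ls := ℓb) (Nc := Nb) hmodS
            (show czmap ℓb Nb (e y) = czmap ℓb Nb (e x) by rw [← hβ, ← hβ]; exact hAQ x y hxy)
          exact tball_mono (Nat.sub_le ℓb 1) h1
        · exact tball_mono (by omega) (hADr x y hDz)
    have h2 := czmap_mem_tball (Ls := ℓb) (Nc := Nb) hmodS hsite
    rw [← hβ x, ← hβ y] at h2
    exact h2
  have hdiv : ℓb / ℓb + 1 = 2 := by rw [Nat.div_self hℓb]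
  -- (201) on the torus: the later links
  have hR' := fun w u v => eq201_torus (M₀ := M₀) hmodS e he β hβ hη hc.le hR hblk hGg hG₂ hwin cz H hH nbp nbm hnbp
    hnbm A AD AQ hA hAD hAQ haQ hAQn G hC₀ hC₀' h198a h198b w u v
  -- the derivative matrix `∂_μ` and the differentiated first link
  obtain ⟨D, hD⟩ := exists_rowDiff_matrix (E := E) (nbp μ) η⁻¹
  have hCD : 0 ≤ 4 * Real.exp (c * 6) * Gg * C₀ * (η * ((ℓb * M₀ : ℕ) : ℝ))⁻¹ + C₀' := by positivity
  have h0' : ∀ w u v, ‖(D * link0 H G w) u v‖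
      ≤ (4 * Real.exp (c * 6) * Gg * C₀ * (η * ((ℓb * M₀ : ℕ) : ℝ))⁻¹ + C₀')
        * ((η ^ 3 * ((η * dOne (vmaVec (e u - e v))) ^ (-(1 : ℝ)) + (η * dOne (vmaVec (e u - e v))) ^ (-(2 : ℝ))))
          * Real.exp (-(c * torusDist (β u) (β v)))) := by
    intro w u v
    rw [hD]
    exact norm_fwdDiff_link0_le hmodS e β hβ hη hc.le hGg hwin cz H hH nbp hnbp G hC₀ h198a h198b w μ u v
  obtain ⟨-, hb⟩ := dimock_thm2_deriv_torus hmod β ctr hctr (fun w => w) (fun _ _ h => h)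
    (fun _ => τ / (ℓb : ℤ)) hc₀ anc hanc hθ hc hQ0 hQ0
    (hconv_shape_torus_boson e he β hη hR hblk) (hconv_shape_torus_boson e he β hη hR hblk)
    (fun w x => algebraMap ℝ E (g (fun i => (((ℓb * M₀ : ℕ) : ℝ))⁻¹ * (((e x - cz w) i).valMinAbs : ℝ) - t)))
    H hH hφ A hA' (by rw [hdiv]; exact hRρ) G hsum hC₁ hR' hlarge D (nbp μ) η⁻¹ hD hCD h0'
  have h := hb x y
  rw [hD] at h
  exact h

/-- **THEOREM 2 (194)–(196) on the 3-torus, EVERY SCALE AND VOLUME, with the bookkeeping discharged** (the (196) twin of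
`dimock_thm2_torus_uniform'`): unit blocks (`ηℓ_b = 1`, `R = ℓ_b`), the printed size of the averaging kernel `a_Q = aη³`,
the bump centred at the cube corners (`t = τ = 0`), support radius `r = ℓ_b(M₀ − 4)`, `N_c ≥ 2`, `M₀ ≥ 12`; then the
constants do not depend on `k` or the volume: *"Let `M_0` be sufficiently large"* is the single condition
`2·3³·C₁θ′K₁(3,c∕2) ≤ M₀` of `dimock_thm2_torus_uniform'`, and **(196)** holds with the ONE constant `4·3³·(4e^{6c}GC₀ + C₀′)`
(`(ηℓ)^{−1} = M₀^{−1} ≤ 1`).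
[cite: Dimock2004QED3TorusII, §3.3 Thm 2 (194)–(196) p.30 L1–13 («Let M_0 be sufficiently large»), Lemma 3 (197)–(198) p.30 L14–22, proof (199)–(204) p.30 L24 – p.31 L12] -/
theorem dimock_thm2_deriv_torus_uniform' [CompleteSpace E] {c η Gg a C₀ C₀' : ℝ} {G₂ : ℝ≥0} {Ns ℓb : ℕ}
    [NeZero Ns] [NeZero ℓb]
    (hmod : Nb = M₀ * Nc) (hmodS : Ns = ℓb * Nb) (hNc : 2 ≤ Nc) (hM₀ : 12 ≤ M₀)
    (e : X → TPt 3 Ns) (he : Function.Injective e)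
    (β : X → TPt 3 Nb) (hβ : ∀ x, β x = czmap ℓb Nb (e x)) (ctr : TPt 3 Nb → X) (hctr : ∀ b, β (ctr b) = b)
    (hblk : ∀ b, (univ.filter fun u => β u = b).card ≤ ℓb ^ 3) (hη : 0 < η) (hunit : η * ℓb = 1) (hc : 0 < c)
    (hGg : ∀ z : Fin 3 → ℝ, ‖fderiv ℝ (g : (Fin 3 → ℝ) → ℝ) z‖ ≤ Gg)
    (hG₂ : LipschitzWith G₂ (fderiv ℝ (g : (Fin 3 → ℝ) → ℝ)))
    {cz : TPt 3 Nc → TPt 3 Ns} (hcz : ∀ w, cz w = proj Ns fun i => ((ℓb * M₀ : ℕ) : ℤ) * natLift w i)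
    (H : TPt 3 Nc → Matrix X X E)
    (hH : ∀ w, H w = Matrix.diagonal fun x =>
      algebraMap ℝ E (g (fun i => (((ℓb * M₀ : ℕ) : ℝ))⁻¹ * (((e x - cz w) i).valMinAbs : ℝ))))
    (nbp nbm : Fin 3 → X → X) (hnbp : ∀ μ x, e (nbp μ x) = e x + proj Ns (Pi.single μ 1))
    (hnbm : ∀ μ x, e (nbm μ x) = e x + proj Ns (-Pi.single μ 1))
    (A AD AQ : Matrix X X E) (hA : ∀ x u, x ≠ u → A x u = AD x u + AQ x u)
    (hAD : ∀ (S : X → E) (x : X), ∑ u, AD x u * S u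
      = (-(η⁻¹ ^ 2)) • ∑ μ, (S (nbp μ x) + S (nbm μ x) - (2 : ℝ) • S x))
    (hADr : ∀ x u, AD x u ≠ 0 → e u ∈ tball (e x) 1)
    (hAQ : ∀ x u, AQ x u ≠ 0 → β u = β x) (ha : 0 ≤ a) (hAQn : ∀ x u, ‖AQ x u‖ ≤ a * η ^ 3)
    (G : TPt 3 Nc → Matrix X X E) (h136 : ∀ w, H w * A * G w = H w)
    (hC₀ : 0 ≤ C₀) (hC₀' : 0 ≤ C₀')
    (h198a : ∀ w u v, ‖G w u v‖ ≤ C₀ * ((η ^ 3 * (η * dOne (vmaVec (e u - e v))) ^ (-(1 : ℝ)))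
      * Real.exp (-(c * torusDist (β u) (β v)))))
    (h198b : ∀ w x μ v, ‖G w (nbp μ x) v - G w x v‖ ≤ C₀' * (η * ((η ^ 3 *
      ((η * dOne (vmaVec (e x - e v))) ^ (-(1 : ℝ)) + (η * dOne (vmaVec (e x - e v))) ^ (-(2 : ℝ))))
        * Real.exp (-(c * torusDist (β x) (β v))))))
    (hlarge : 2 * (27 * (((3 * Real.exp (c * 6) * (4 * G₂ * C₀ + 5 * Gg * C₀') + Gg * a * C₀ * (2 + 2 * blockConst 1))
        * (4 * blockConst 1 + 2 * (Real.sqrt 8 * blockConst 2) + 8 * blockConst 2)) * K₁ 3 (c / 2))) ≤ (M₀ : ℝ)) :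
    (∀ x y, Summable fun n => (Gstar H G * Kop A H G ^ n) x y) ∧
    A * walkExpansion A H G = 1 ∧
    (∀ x y, ‖walkExpansion A H G x y‖
      ≤ 2 * ((3 ^ 3 : ℕ) : ℝ) * C₀ * ((η ^ 3 * (η * dOne (vmaVec (e x - e y))) ^ (-(1 : ℝ)))
          * Real.exp (-(c / 2) * torusDist (β x) (β y)))) ∧
    ∀ μ x y, ‖η⁻¹ • (walkExpansion A H G (nbp μ x) y - walkExpansion A H G x y)‖
      ≤ 4 * ((3 ^ 3 : ℕ) : ℝ) * (4 * Real.exp (c * 6) * Gg * C₀ + C₀')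
          * ((η ^ 3 * ((η * dOne (vmaVec (e x - e y))) ^ (-(1 : ℝ)) + (η * dOne (vmaVec (e x - e y))) ^ (-(2 : ℝ))))
            * Real.exp (-(c / 2) * torusDist (β x) (β y))) := by
  have hℓb : 0 < ℓb := Nat.pos_of_ne_zero (NeZero.ne ℓb)
  have hR : 1 ≤ ℓb := hℓb
  have hℓbr : (1 : ℝ) ≤ ℓb := by exact_mod_cast hℓb
  have hM₀r : (12 : ℝ) ≤ M₀ := by exact_mod_cast hM₀
  have hNcr : (2 : ℝ) ≤ Nc := by exact_mod_cast hNc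
  have hM₀4 : 4 ≤ M₀ := le_trans (by norm_num) hM₀
  have hGg0 : 0 ≤ Gg := (norm_nonneg _).trans (hGg 0)
  have hprod : 12 * (ℓb : ℝ) ≤ (ℓb : ℝ) * M₀ := by nlinarith
  have hprod2 : 2 * ((ℓb : ℝ) * M₀) ≤ (ℓb : ℝ) * M₀ * Nc := by nlinarith
  have hℓ : (((ℓb * M₀ : ℕ)) : ℝ) = (ℓb : ℝ) * M₀ := by push_cast; ring
  -- the bookkeeping (as in `dimock_thm2_torus_uniform'`)
  have hH' : ∀ w, H w = Matrix.diagonal fun x =>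
      algebraMap ℝ E (g (fun i => (((ℓb * M₀ : ℕ) : ℝ))⁻¹ * (((e x - cz w) i).valMinAbs : ℝ) - 0)) := by
    simp_rw [sub_zero]
    exact hH
  have hdiv : ℓb * (M₀ - 4) / ℓb = M₀ - 4 := Nat.mul_div_cancel_left (M₀ - 4) hℓb
  have hNc' : 2 * |(0 : ℝ)| + 6 / 5 < (Nc : ℝ) := by
    rw [abs_zero, mul_zero, zero_add]
    linarith
  have hτℓ' : (0 : ℤ) < ((ℓb * M₀ : ℕ) : ℤ) := by exact_mod_cast Nat.mul_pos hℓb (by omega : 0 < M₀)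
  have hτ' : |((ℓb * M₀ : ℕ) : ℝ) * 0 - ((0 : ℤ) : ℝ)| ≤ 1 / 2 := by
    rw [mul_zero, Int.cast_zero, sub_zero, abs_zero]
    norm_num
  have hr' : (3 / 5 : ℝ) * ((ℓb * M₀ : ℕ) : ℝ) + 1 / 2 ≤ ((ℓb * (M₀ - 4) : ℕ) : ℝ) := by
    have e1 : ((ℓb * (M₀ - 4) : ℕ) : ℝ) = (ℓb : ℝ) * M₀ - 4 * ℓb := by
      push_cast [Nat.cast_sub hM₀4]
      ring
    rw [hℓ, e1]
    linarith
  have hwin' : (((ℓb * M₀ : ℕ)) : ℝ) * (|(0 : ℝ)| + 3 / 5) + ℓb + 2 < (Ns : ℝ) / 2 := by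
    have hNs : (Ns : ℝ) = (ℓb : ℝ) * M₀ * Nc := by rw [hmodS, hmod]; push_cast; ring
    rw [hℓ, abs_zero, zero_add, hNs]
    linarith
  have hRρ1 : 2 * (ℓb * (M₀ - 4) / ℓb + 1) + 2 < 2 * M₀ := by
    rw [hdiv]
    omega
  have hRρ2 : (ℓb * (M₀ - 4) / ℓb + 1) + 2 < M₀ := by
    rw [hdiv]
    omega
  -- the weakening `(ηℓ)⁻¹ = M₀⁻¹ ≤ 1` of the (196) constant
  have hinv1 : (η * ((ℓb * M₀ : ℕ) : ℝ))⁻¹ ≤ 1 := by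
    rw [hℓ, ← mul_assoc, hunit, one_mul]
    exact inv_le_one_of_one_le₀ (by linarith)
  have hmono : 4 * Real.exp (c * 6) * Gg * C₀ * (η * ((ℓb * M₀ : ℕ) : ℝ))⁻¹ + C₀'
      ≤ 4 * Real.exp (c * 6) * Gg * C₀ + C₀' := by
    have h0 : 0 ≤ 4 * Real.exp (c * 6) * Gg * C₀ := by positivity
    have h1 := mul_le_mul_of_nonneg_left hinv1 h0
    linarith
  have h27' : (0 : ℝ) ≤ 4 * ((3 ^ 3 : ℕ) : ℝ) := by positivity
  -- the largeness constant at unit blocks (as in `dimock_thm2_torus_uniform`)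
  have h4 : (2 : ℝ) ^ ((1 : ℝ) + 1) = 4 := by
    rw [show (1 : ℝ) + 1 = ((2 : ℕ) : ℝ) by norm_num, Real.rpow_natCast]
    norm_num
  have h8 : (2 : ℝ) ^ ((2 : ℝ) + 1) = 8 := by
    rw [show (2 : ℝ) + 1 = ((3 : ℕ) : ℝ) by norm_num, Real.rpow_natCast]
    norm_num
  have h1a : (η * (ℓb : ℝ)) ^ ((3 : ℝ) - 1) = 1 := by rw [hunit, Real.one_rpow]
  have h1b : (η * (ℓb : ℝ)) ^ ((3 : ℝ) - 2) = 1 := by rw [hunit, Real.one_rpow]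
  have hη0 : η ≠ 0 := hη.ne'
  have key : ((3 * Real.exp (c * 6) * (4 * G₂ * C₀ * ((η * ℓb) ^ 2)⁻¹ + 5 * Gg * C₀' * (η * ℓb)⁻¹)
        + Gg * (a * η ^ 3) * C₀ * (2 * (η * ℓb) ^ 3 + 2 * blockConst 1 * (η * ℓb) ^ 2 * (η * ℓb)) / η ^ 3))
      * (2 ^ ((1 : ℝ) + 1) * blockConst 1 * (η * ℓb) ^ ((3 : ℝ) - 1)
        + 2 * (Real.sqrt 8 * blockConst 2 * (η * ℓb)) + 2 ^ ((2 : ℝ) + 1) * blockConst 2 * (η * ℓb) ^ ((3 : ℝ) - 2))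
      = (3 * Real.exp (c * 6) * (4 * G₂ * C₀ + 5 * Gg * C₀') + Gg * a * C₀ * (2 + 2 * blockConst 1))
        * (4 * blockConst 1 + 2 * (Real.sqrt 8 * blockConst 2) + 8 * blockConst 2) := by
    rw [h1a, h1b, hunit, h4, h8]
    field_simp
  have h27 : ((3 ^ 3 : ℕ) : ℝ) = 27 := by norm_num
  have hlarge' : 2 * (((3 ^ 3 : ℕ) : ℝ) *
      (((3 * Real.exp (c * 6) * (4 * G₂ * C₀ * ((η * ℓb) ^ 2)⁻¹ + 5 * Gg * C₀' * (η * ℓb)⁻¹)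
          + Gg * (a * η ^ 3) * C₀ * (2 * (η * ℓb) ^ 3 + 2 * blockConst 1 * (η * ℓb) ^ 2 * (η * ℓb)) / η ^ 3))
        * (2 ^ ((1 : ℝ) + 1) * blockConst 1 * (η * ℓb) ^ ((3 : ℝ) - 1)
          + 2 * (Real.sqrt 8 * blockConst 2 * (η * ℓb))
          + 2 ^ ((2 : ℝ) + 1) * blockConst 2 * (η * ℓb) ^ ((3 : ℝ) - 2)) * K₁ 3 (c / 2))) ≤ (M₀ : ℝ) := by
    rw [key, h27]
    exact hlarge
  obtain ⟨hsum, hinv, h195, h196⟩ := dimock_thm2_deriv_torus_lemma3 (t := 0) (τ := 0) (r := ℓb * (M₀ - 4))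
    hmod hmodS hNc' e he β hβ ctr hctr hblk hR hη hc hGg hG₂ hcz le_rfl hτℓ' hτ' hr' hwin' H hH' nbp nbm hnbp hnbm A AD
    AQ hA hAD hADr hAQ (by positivity) hAQn hRρ1 hRρ2 G h136 hC₀ hC₀' h198a h198b hlarge'
  refine ⟨hsum, hinv, h195, fun μ x y => (h196 μ x y).trans ?_⟩
  have hΦ : 0 ≤ (η ^ 3 * ((η * dOne (vmaVec (e x - e y))) ^ (-(1 : ℝ))
      + (η * dOne (vmaVec (e x - e y))) ^ (-(2 : ℝ)))) * Real.exp (-(c / 2) * torusDist (β x) (β y)) :=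
    mul_nonneg (mul_nonneg (pow_nonneg hη.le 3) (add_nonneg (Real.rpow_nonneg (dprimeT_pos hη (e x) (e y)).le _)
      (Real.rpow_nonneg (dprimeT_pos hη (e x) (e y)).le _))) (Real.exp_pos _).le
  exact mul_le_mul_of_nonneg_right (mul_le_mul_of_nonneg_left hmono h27') hΦ

omit [NeZero Nc] in
/-- **THEOREM 2 (195)–(196) FOR EVERY PATH, single scale, on the 3-torus, FROM LEMMA 3 ALONE** — the first lines of
(195) and (196): for every cube sequence `ω = (□_0,…,□_n)` (the path term `G_{k,Λ,ω} = (h_{□_0}G*_{□_0}h_{□_0})(R_{□_1}G*_{□_1}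
h_{□_1})⋯(R_{□_n}G*_{□_n}h_{□_n})` of (199), the tree's `chainProd`; zero unless `ω` is a path) —
`‖G_{k,Λ,ω}(x,y)‖ ≤ C₀(C₁θ′K₁(3,c∕2)∕M₀)^{|ω|}·η³d′_T(e x,e y)^{−1}e^{−(c∕2)d(Δ_x,Δ_y)}` and
`‖η^{−1}(G_{k,Λ,ω}(x + e_μ,y) − G_{k,Λ,ω}(x,y))‖ ≤ (4e^{6c}GC₀(ηℓ)^{−1} + C₀′)(C₁θ′K₁(3,c∕2)∕M₀)^{|ω|}·η³(d′_T^{−1} + d′_T^{−2})(e x,e y)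
e^{−(c∕2)d(Δ_x,Δ_y)}` — the printed `O(1)(O(1)M_0^{−1})^{|ω|}(…)exp(−O(1)d_Λ(x,y))` with every `O(1)` explicit
(`C₁`, `θ′` those of `dimock_thm2_torus_lemma3`); NO largeness condition is needed for the single path.  Data and
hypotheses as in `dimock_thm2_deriv_torus_lemma3` without (125), (197), the support radii and *"`M_0` sufficiently
large"*; by `norm_chainProd_apply_le` ∕ `norm_dm_mul_chainProd_apply_le` with the torus geometry (`r = 0`,
`K = K₁(3,c∕2)`), (201) by `eq201_torus`, (202)–(204) by `hconv_shape_torus_boson` ∕ `hconv₀_shape_torus_boson`, the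
differentiated first link by `norm_fwdDiff_link0_le`.
[cite: Dimock2004QED3TorusII, §3.3 Thm 2 (195)–(196) first lines p.30 L3–4 and L8–10, Lemma 3 (197)–(198) p.30 L14–22, proof (199)–(204) p.30 L24 – p.31 L12] -/
theorem dimock_thm2_path_torus_lemma3 {c η t Gg aQ C₀ C₀' : ℝ} {G₂ : ℝ≥0} {Ns ℓb R : ℕ}
    [NeZero Ns] [NeZero ℓb]
    (hmodS : Ns = ℓb * Nb)
    (e : X → TPt 3 Ns) (he : Function.Injective e)
    (β : X → TPt 3 Nb) (hβ : ∀ x, β x = czmap ℓb Nb (e x)) (ctr : TPt 3 Nb → X) (hctr : ∀ b, β (ctr b) = b)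
    (hblk : ∀ b, (univ.filter fun u => β u = b).card ≤ R ^ 3) (hR : 1 ≤ R) (hη : 0 < η) (hc : 0 < c)
    (hGg : ∀ z : Fin 3 → ℝ, ‖fderiv ℝ (g : (Fin 3 → ℝ) → ℝ) z‖ ≤ Gg)
    (hG₂ : LipschitzWith G₂ (fderiv ℝ (g : (Fin 3 → ℝ) → ℝ)))
    (hwin : (((ℓb * M₀ : ℕ)) : ℝ) * (|t| + 3 / 5) + ℓb + 2 < (Ns : ℝ) / 2)
    (cz : TPt 3 Nc → TPt 3 Ns) (H : TPt 3 Nc → Matrix X X E)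
    (hH : ∀ w, H w = Matrix.diagonal fun x =>
      algebraMap ℝ E (g (fun i => (((ℓb * M₀ : ℕ) : ℝ))⁻¹ * (((e x - cz w) i).valMinAbs : ℝ) - t)))
    (nbp nbm : Fin 3 → X → X) (hnbp : ∀ μ x, e (nbp μ x) = e x + proj Ns (Pi.single μ 1))
    (hnbm : ∀ μ x, e (nbm μ x) = e x + proj Ns (-Pi.single μ 1))
    (A AD AQ : Matrix X X E) (hA : ∀ x u, x ≠ u → A x u = AD x u + AQ x u)
    (hAD : ∀ (S : X → E) (x : X), ∑ u, AD x u * S u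
      = (-(η⁻¹ ^ 2)) • ∑ μ, (S (nbp μ x) + S (nbm μ x) - (2 : ℝ) • S x))
    (hAQ : ∀ x u, AQ x u ≠ 0 → β u = β x) (haQ : 0 ≤ aQ) (hAQn : ∀ x u, ‖AQ x u‖ ≤ aQ)
    (G : TPt 3 Nc → Matrix X X E) (hC₀ : 0 ≤ C₀) (hC₀' : 0 ≤ C₀')
    (h198a : ∀ w u v, ‖G w u v‖ ≤ C₀ * ((η ^ 3 * (η * dOne (vmaVec (e u - e v))) ^ (-(1 : ℝ)))
      * Real.exp (-(c * torusDist (β u) (β v)))))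
    (h198b : ∀ w x μ v, ‖G w (nbp μ x) v - G w x v‖ ≤ C₀' * (η * ((η ^ 3 *
      ((η * dOne (vmaVec (e x - e v))) ^ (-(1 : ℝ)) + (η * dOne (vmaVec (e x - e v))) ^ (-(2 : ℝ))))
        * Real.exp (-(c * torusDist (β x) (β v))))))
    {n : ℕ} (ω : Fin (n + 1) → TPt 3 Nc) (x y : X) :
    ‖chainProd A H G ω x y‖
      ≤ C₀ * ((3 * Real.exp (c * 6) * (4 * G₂ * C₀ * ((η * ℓb) ^ 2)⁻¹ + 5 * Gg * C₀' * (η * ℓb)⁻¹)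
            + Gg * aQ * C₀ * (2 * (η * R) ^ 3 + 2 * blockConst 1 * (η * R) ^ 2 * (η * ℓb)) / η ^ 3)
          * (2 ^ ((1 : ℝ) + 1) * blockConst 1 * (η * R) ^ ((3 : ℝ) - 1)
            + 2 * (Real.sqrt 8 * blockConst 2 * (η * R))
            + 2 ^ ((2 : ℝ) + 1) * blockConst 2 * (η * R) ^ ((3 : ℝ) - 2)) * K₁ 3 (c / 2) / (M₀ : ℝ)) ^ n
        * ((η ^ 3 * (η * dOne (vmaVec (e x - e y))) ^ (-(1 : ℝ))) * Real.exp (-(c / 2) * torusDist (β x) (β y))) ∧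
    ∀ μ, ‖η⁻¹ • (chainProd A H G ω (nbp μ x) y - chainProd A H G ω x y)‖
      ≤ (4 * Real.exp (c * 6) * Gg * C₀ * (η * ((ℓb * M₀ : ℕ) : ℝ))⁻¹ + C₀')
        * ((3 * Real.exp (c * 6) * (4 * G₂ * C₀ * ((η * ℓb) ^ 2)⁻¹ + 5 * Gg * C₀' * (η * ℓb)⁻¹)
            + Gg * aQ * C₀ * (2 * (η * R) ^ 3 + 2 * blockConst 1 * (η * R) ^ 2 * (η * ℓb)) / η ^ 3)
          * (2 ^ ((1 : ℝ) + 1) * blockConst 1 * (η * R) ^ ((3 : ℝ) - 1)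
            + 2 * (Real.sqrt 8 * blockConst 2 * (η * R))
            + 2 ^ ((2 : ℝ) + 1) * blockConst 2 * (η * R) ^ ((3 : ℝ) - 2)) * K₁ 3 (c / 2) / (M₀ : ℝ)) ^ n
        * ((η ^ 3 * ((η * dOne (vmaVec (e x - e y))) ^ (-(1 : ℝ)) + (η * dOne (vmaVec (e x - e y))) ^ (-(2 : ℝ))))
          * Real.exp (-(c / 2) * torusDist (β x) (β y))) := by
  have hM₀ : 0 < M₀ := Nat.pos_of_ne_zero (NeZero.ne M₀)
  have hM₀r : (0 : ℝ) < M₀ := by exact_mod_cast hM₀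
  have hGg0 : 0 ≤ Gg := (norm_nonneg _).trans (hGg 0)
  have hηR : 0 ≤ η * R := mul_nonneg hη.le (Nat.cast_nonneg R)
  have hC1 : 0 ≤ blockConst 1 := zero_le_one.trans (one_le_blockConst (α := 1) (by norm_num))
  have hC2 : 0 ≤ blockConst 2 := zero_le_one.trans (one_le_blockConst (α := 2) (by norm_num))
  have hθ : 0 ≤ 2 ^ ((1 : ℝ) + 1) * blockConst 1 * (η * R) ^ ((3 : ℝ) - 1)
      + 2 * (Real.sqrt 8 * blockConst 2 * (η * R)) + 2 ^ ((2 : ℝ) + 1) * blockConst 2 * (η * R) ^ ((3 : ℝ) - 2) := by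
    positivity
  have hC₁ : 0 ≤ (3 * Real.exp (c * 6) * (4 * G₂ * C₀ * ((η * ℓb) ^ 2)⁻¹ + 5 * Gg * C₀' * (η * ℓb)⁻¹)
      + Gg * aQ * C₀ * (2 * (η * R) ^ 3 + 2 * blockConst 1 * (η * R) ^ 2 * (η * ℓb)) / η ^ 3) := by positivity
  have hQ0 : ∀ u v : X, 0 ≤ η ^ 3 * ((η * dOne (vmaVec (e u - e v))) ^ (-(1 : ℝ))
      + (η * dOne (vmaVec (e u - e v))) ^ (-(2 : ℝ))) := fun u v =>
    mul_nonneg (pow_nonneg hη.le 3) (add_nonneg (Real.rpow_nonneg (dprimeT_pos hη (e u) (e v)).le _)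
      (Real.rpow_nonneg (dprimeT_pos hη (e u) (e v)).le _))
  have hP₀0 : ∀ u v : X, 0 ≤ η ^ 3 * (η * dOne (vmaVec (e u - e v))) ^ (-(1 : ℝ)) := fun u v =>
    mul_nonneg (pow_nonneg hη.le 3) (Real.rpow_nonneg (dprimeT_pos hη (e u) (e v)).le _)
  -- the first links against (198), the later links by (201)
  have hf1 : ∀ (w : TPt 3 Nc) (x : X),
      |g (fun i => (((ℓb * M₀ : ℕ) : ℝ))⁻¹ * (((e x - cz w) i).valMinAbs : ℝ) - t)| ≤ 1 :=
    fun w x => abs_le.2 ⟨by linarith [g_nonneg (fun i => (((ℓb * M₀ : ℕ) : ℝ))⁻¹ *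
      (((e x - cz w) i).valMinAbs : ℝ) - t)], g_le_one _⟩
  have h0 : ∀ w u v, ‖link0 H G w u v‖ ≤ C₀ * ((η ^ 3 * (η * dOne (vmaVec (e u - e v))) ^ (-(1 : ℝ)))
      * Real.exp (-(c * torusDist (β u) (β v)))) := fun w u v =>
    (norm_link0_le (fun w x => g (fun i => (((ℓb * M₀ : ℕ) : ℝ))⁻¹ * (((e x - cz w) i).valMinAbs : ℝ) - t))
      hH hf1 G w u v).trans (h198a w u v)
  have hR' := fun w u v => eq201_torus (M₀ := M₀) hmodS e he β hβ hη hc.le hR hblk hGg hG₂ hwin cz H hH nbp nbm hnbp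
    hnbm A AD AQ hA hAD hAQ haQ hAQn G hC₀ hC₀' h198a h198b w u v
  have hCD : 0 ≤ 4 * Real.exp (c * 6) * Gg * C₀ * (η * ((ℓb * M₀ : ℕ) : ℝ))⁻¹ + C₀' := by positivity
  -- the torus geometry of `dimock195`: `d := torusDist ∘ Δ`, `r = 0`, `K = K₁(3, c∕2)`
  have hrad : ∀ u : X, torusDist (β u) (β (ctr (β u))) ≤ 0 := fun u => by rw [hctr, torusDist_self']
  have hK : ∀ b : TPt 3 Nb, ∑ b', Real.exp (-(c / 2) * torusDist (β (ctr b)) (β (ctr b'))) ≤ K₁ 3 (c / 2) := by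
    intro b
    simp_rw [hctr]
    exact sum_exp_torusDist_le (half_pos hc) b
  constructor
  · have h := norm_chainProd_apply_le (d := fun u v => torusDist (β u) (β v)) (ctr := ctr) (r := 0) (blk := β)
      hθ hc.le hQ0 hP₀0 (hconv_shape_torus_boson e he β hη hR hblk) (hconv₀_shape_torus_boson e he β hη hR hblk)
      (fun u v => torusDist_nonneg _ _) (fun u v => torusDist_comm' _ _) (fun u v t => torusDist_triangle _ _ _)
      hrad hK A H G hC₀ hC₁ hM₀r h0 hR' ω x y
    rw [mul_zero, mul_zero, Real.exp_zero, mul_one, mul_one] at h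
    simpa only [mul_assoc] using h
  · intro μ
    obtain ⟨D, hD⟩ := exists_rowDiff_matrix (E := E) (nbp μ) η⁻¹
    have h0' : ∀ w u v, ‖(D * link0 H G w) u v‖
        ≤ (4 * Real.exp (c * 6) * Gg * C₀ * (η * ((ℓb * M₀ : ℕ) : ℝ))⁻¹ + C₀')
          * ((η ^ 3 * ((η * dOne (vmaVec (e u - e v))) ^ (-(1 : ℝ)) + (η * dOne (vmaVec (e u - e v))) ^ (-(2 : ℝ))))
            * Real.exp (-(c * torusDist (β u) (β v)))) := by
      intro w u v
      rw [hD]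
      exact norm_fwdDiff_link0_le hmodS e β hβ hη hc.le hGg hwin cz H hH nbp hnbp G hC₀ h198a h198b w μ u v
    have h := norm_dm_mul_chainProd_apply_le (d := fun u v => torusDist (β u) (β v)) (ctr := ctr) (r := 0) (blk := β)
      hθ hc.le hQ0 hQ0 (hconv_shape_torus_boson e he β hη hR hblk) (hconv_shape_torus_boson e he β hη hR hblk)
      (fun u v => torusDist_nonneg _ _) (fun u v => torusDist_comm' _ _) (fun u v t => torusDist_triangle _ _ _)
      hrad hK D A H G hCD hC₁ hM₀r h0' hR' ω x y
    rw [mul_zero, mul_zero, Real.exp_zero, mul_one, mul_one, hD] at h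
    simpa only [mul_assoc] using h

end Theorem2Deriv

end QED3TorusII

end Literature.MathematicalPhysics.QuantumFieldTheory.Dimock2011to13
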